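import Literature.Analysis.FunctionSpaces.SobolevTraceDensityProofs
import Mathlib.MeasureTheory.Function.ConvergenceInMeasure
import HarnessLib

/-!
# Discharged fact: Rellich–Kondrachov on `W^{1,p}(Ω)` of a bounded Lipschitz domain (`SobolevTrace`)

`Literature.Analysis.FunctionSpaces.SobolevTrace` states the Rellich–Kondrachov compactness
theorem on `W^{1,p}(Ω)` of a bounded Lipschitz domain as the named fact
`Literature.Analysis.FunctionSpaces.rellich_kondrachov_domain` (R. A. Adams, J. J. F. Fournier, *Sobolev Spaces*, 2nd ed.
(2003), Thm. 6.3 = R. A. Adams, *Sobolev Spaces* (1975), Thm. 6.2 "The Rellich–Kondrachov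
theorem", Parts I and II with `j = 0`, `m = 1`, `k = n`, `q = p` and `Ω₀ = Ω` bounded: for a
domain with the cone property — bounded Lipschitz domains have it — the imbedding
`W^{1,p}(Ω) → L^p(Ω)` is compact, `1 ≤ p < ∞`; L. C. Evans, *Partial Differential Equations*,
2nd ed. (2010), §5.7, Theorem 1 for `C¹` boundaries; the fact also includes `p = ∞`, see its
docstring). This file proves it, in the sequential form of the fact (finite-dimensional range
`F`, any additive Haar measure `μ`, `1 ≤ p ≤ ∞`):

* `Literature.rellich_kondrachov_domain_holds : rellich_kondrachov_domain`;
* `Literature.Analysis.FunctionSpaces.rellich_kondrachov_domain'_holds : rellich_kondrachov_domain'`,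
  the corrected statement (which binds `[BorelSpace E']` and `[FiniteDimensional ℝ F]` inside the
  proposition), proved outright from the former.

## Proof

The architecture is that of Evans, §5.7, proof of Theorem 1 (steps 2–6: mollify the family at
a scale `~ ε`, control the mollification error by `ε ‖Du‖_p`, apply Arzelà–Ascoli to the
mollified family, pass from the sup norm to `L^p`, and extract a subsequence from total
boundedness), which is also how the accepted `Literature.Analysis.FunctionSpaces.rellich_kondrachov_holds`
(`SobolevDomainProofs`, the `W₀^{1,p}` case) proceeds. Evans first extends `uₘ` to
`W^{1,p}(ℝⁿ)` (§5.4, which needs `C¹` boundaries or the Calderón–Stein theorem); Adams (1975),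
§6.7 instead removes a boundary layer using the Sobolev imbedding theorem and proves the
translation estimate (16) in the interior by density of `C^∞(Ω)`. Neither the extension
theorem nor the imbedding theorem is available here; both are avoided by *localising to
Lipschitz charts and mollifying after a small translation into the domain*, the device of the
density theorem for `C^∞(Ω̄)` (Evans §5.3.3, Theorem 3; Adams 1975, Theorem 3.18), whose
geometric core — the cone property of a Lipschitz epigraph,
`Literature.Analysis.FunctionSpaces.SobolevApprox.closedBall_add_smul_subset_of_graph` — and whose calculus
(`hasWeakFDerivOn_smul`, `hasFDerivAt_convolution_of_tsupport_subset`, `L^p` convergence of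
translated mollifiers) are taken from the accepted `SobolevTraceDensityProofs`.

1. *Shifted mollification of integrable functions* (Part 1): sup, Lipschitz and support
   bounds of `ρ ⋆ G` for a bump `ρ` of arbitrary centre and `G ∈ L¹` (Evans, step 4).
2. *`C¹` estimates* (Part 2): `‖ρ ⋆ V - V‖ ≤ (‖c‖ + R) sup ‖DV‖` pointwise (mean value
   inequality on segments) and `∫_S ‖ρ ⋆ V - V‖^q ≤ (‖c‖ + R)^q ∫ H^q` whenever `H`
   dominates `‖DV‖` on the segments issued from `S` (Evans, step 3; Adams, proof of Thm. 2.21,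
   display (25): Jensen for the probability measure `ρ dμ`, the fundamental theorem of
   calculus along segments, Tonelli, translation invariance).
3. *The estimate for weakly differentiable functions, `1 ≤ p ≤ ∞`* (Part 3,
   `eLpNorm_normed_convolution_sub_self_le_of_hasWeakFDerivOn`): if `g` is a weak derivative
   of `G` on `Ω` and the reflected kernel supports along the segments from `S` stay in `Ω`,
   then `‖ρ ⋆ G - G‖_{L^p(S)} ≤ (‖c‖ + R) ‖g‖_{L^p}`. Proof without density theorem:
   `Vₖ = ρ'ₖ ⋆ G → G` in `L¹`, hence a.e. along a subsequence
   (`TendstoInMeasure.exists_seq_tendsto_ae`), `ρ ⋆ Vₖ → ρ ⋆ G` everywhere, `DVₖ = ρ'ₖ ⋆ g`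
   on the region, the `C¹` estimates for `Vₖ`, Young's inequality `‖ρ'ₖ ⋆ g‖_p ≤ ‖g‖_p`
   (accepted `Literature.Analysis.UnboundedOperators.lintegral_rpow_enorm_convolution_le`), and Fatou's lemma (`p < ∞`) resp. a
   pointwise bound (`p = ∞`).
4. *Geometry of the patches* (Part 4) and *the patch estimate* (Part 5, `patch_estimate`):
   for a smooth cut-off `ζ`, `‖ζ u - ρ_τ ⋆ 𝟙_Ω ζ u‖_{L^p(Ω)} ≤ 2τ D_ζ (‖u‖_p + ‖Du‖_p)` with
   `ρ_τ` the bump of centre `-τ v` (inward direction `v`) and radius `λ τ`.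
5. *Total boundedness* (Part 6, `exists_finset_eLpNorm_sub_lt_of_isLipschitzDomain`): finite
   cover of the compact `∂Ω` by half-balls of Lipschitz charts, smooth partition of unity
   `(ρᵢ)` on `closure Ω` (`SmoothPartitionOfUnity.exists_isSubordinate`),
   `T u = Σᵢ ρ_{τᵢ} ⋆ 𝟙_Ω ρᵢ u` with `‖uₙ - T uₙ‖_{L^p(Ω)} ≤ ε/4`, an Arzelà–Ascoli net for the
   equibounded, equi-Lipschitz, compactly supported family `{T uₙ}` (accepted
   `Literature.Analysis.FunctionSpaces.exists_finset_forall_norm_sub_lt`), and the triangle inequality; then compactness in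
   the complete space `Lp F p (μ|Ω)` (`exists_subseq_tendsto_eLpNorm_of_isLipschitzDomain`,
   Evans, step 6) and the discharge, which extracts weak derivatives with
   `‖Duₙ‖_{L^p(Ω)} ≤ C_E (M + 1)` from the finite Sobolev norms.

## Mathlib search

Mathlib (this pin) has convolution with smooth compactly supported kernels, bump functions
with arbitrary centres (`ContDiffBump.normed`), smooth partitions of unity, convergence in
measure with a.e.-convergent subsequences, Fatou's lemma (`lintegral_liminf_le'`), the mean
value inequality (`Convex.norm_image_sub_le_of_norm_fderiv_le`) and Arzelà–Ascoli
(`BoundedContinuousFunction.arzela_ascoli`), but no weak derivatives, Sobolev spaces on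
domains, Lipschitz domains or Rellich–Kondrachov theorem (searched `Rellich`, `Kondrachov`,
`Sobolev`, `HasWeakDeriv`); those notions are this library's (`SobolevDomain`, `SobolevTrace`).

## References

* R. A. Adams, J. J. F. Fournier, *Sobolev Spaces*, 2nd ed., Pure and Applied Mathematics
  140, Academic Press (2003), Thm. 6.3 (Rellich–Kondrachov).
* R. A. Adams, *Sobolev Spaces*, Pure and Applied Mathematics 65, Academic Press (1975),
  Thm. 1.18, Thm. 1.30, Lemma 2.18, Thm. 2.21, Lemma 3.15, Thm. 3.18, Thm. 6.2
  (the Rellich–Kondrachov theorem), Remarks 6.3, §6.7 (proof of Thm. 6.2, Part I).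
* L. C. Evans, *Partial Differential Equations*, 2nd ed., Graduate Studies in Mathematics 19,
  AMS (2010), §5.3.3 Theorem 3, §5.7 Theorem 1 and its proof, App. C.4 Theorem 7.
-/

noncomputable section

open MeasureTheory TopologicalSpace Set Function Filter Metric Bornology ContinuousLinearMap
open scoped ENNReal NNReal Convolution ContDiff Topology InnerProductSpace Manifold Pointwise

namespace Literature.Analysis.FunctionSpaces

namespace RellichDomain

/-! ## Part 1. Mollification of integrable functions by shifted bump kernels

Elementary bounds for `ρ ⋆ G`, `ρ = φ.normed μ` the normalised bump of a `ContDiffBump`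
with arbitrary centre `c`, `G ∈ L¹(μ)` (Evans, *PDE*, §5.7, proof of Theorem 1, step 4:
`|u^ε_m| ≤ ‖η_ε‖_∞ ‖u_m‖_{L¹}`, `|Du^ε_m| ≤ ‖Dη_ε‖_∞ ‖u_m‖_{L¹}`; the centred, continuous case
is in the accepted `SobolevDomainProofs`). -/

section Kernel

variable {E' : Type*} [NormedAddCommGroup E'] [NormedSpace ℝ E'] [FiniteDimensional ℝ E']
  [MeasurableSpace E'] [BorelSpace E'] {μ : Measure E'} [μ.IsAddHaarMeasure]
variable {F : Type*} [NormedAddCommGroup F] [NormedSpace ℝ F]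

/-- Uniform bound of a mollified integrable function: `‖(ρ ⋆ G) x‖ ≤ (∫ ρ)⁻¹ ‖G‖_{L¹}` for the
normalised bump `ρ.normed μ` of a bump `ρ` with arbitrary centre (`0 ≤ ρ ≤ 1`) (Evans, *PDE*,
§5.7, proof of Thm. 1, step 4; Adams 1975, proof of Thm. 2.21). [folklore] -/
theorem norm_normed_convolution_le_of_integrable {c : E'} (φ : ContDiffBump c) {G : E' → F}
    (hG : Integrable G μ) (x : E') :
    ‖(φ.normed μ ⋆[lsmul ℝ ℝ, μ] G) x‖ ≤ (∫ y, φ y ∂μ)⁻¹ * ∫ y, ‖G y‖ ∂μ := by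
  rw [convolution_lsmul_swap, ← integral_const_mul]
  have hI : 0 < ∫ y, φ y ∂μ := φ.integral_pos
  refine norm_integral_le_of_norm_le (hG.norm.const_mul _) (ae_of_all _ fun t => ?_)
  rw [norm_smul, Real.norm_of_nonneg (φ.nonneg_normed _)]
  gcongr
  rw [φ.normed_def, div_le_iff₀ hI, inv_mul_cancel₀ hI.ne']
  exact φ.le_one

/-- Integrability of the swapped convolution integrand `t ↦ ρ (z - t) • G t` for a bounded
continuous kernel and an integrable `G`. [folklore] -/
theorem integrable_normed_comp_sub_smul {c : E'} (φ : ContDiffBump c) {G : E' → F}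
    (hG : Integrable G μ) (z : E') : Integrable (fun t => φ.normed μ (z - t) • G t) μ := by
  obtain ⟨C, hC⟩ := (φ.continuous_normed (μ := μ)).bounded_above_of_compact_support
    (φ.hasCompactSupport_normed (μ := μ))
  exact hG.bdd_smul C
    ((φ.continuous_normed.comp (continuous_const.sub continuous_id)).aestronglyMeasurable)
    (ae_of_all _ fun t => hC _)

/-- Lipschitz bound of a mollified integrable function: if `ρ.normed μ` is `L`-Lipschitz then
`ρ ⋆ G` is `L ‖G‖_{L¹}`-Lipschitz (Evans, *PDE*, §5.7, proof of Thm. 1, step 4; Adams 1975,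
proof of Thm. 2.21: equicontinuity of `{J_η ⋆ u}`). [folklore] -/
theorem dist_normed_convolution_le_of_integrable {c : E'} (φ : ContDiffBump c) {G : E' → F}
    (hG : Integrable G μ) {L : ℝ≥0} (hL : LipschitzWith L (φ.normed μ)) (x x' : E') :
    dist ((φ.normed μ ⋆[lsmul ℝ ℝ, μ] G) x) ((φ.normed μ ⋆[lsmul ℝ ℝ, μ] G) x')
      ≤ (L * ∫ y, ‖G y‖ ∂μ) * dist x x' := by
  have hint := integrable_normed_comp_sub_smul φ hG (μ := μ)
  rw [convolution_lsmul_swap, convolution_lsmul_swap, dist_eq_norm,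
    ← integral_sub (hint x) (hint x')]
  simp_rw [← sub_smul]
  rw [show (L * ∫ y, ‖G y‖ ∂μ) * dist x x' = ∫ y, L * dist x x' * ‖G y‖ ∂μ by
    rw [integral_const_mul]; ring]
  refine norm_integral_le_of_norm_le (hG.norm.const_mul _) (ae_of_all _ fun t => ?_)
  rw [norm_smul]
  gcongr
  rw [← dist_eq_norm]
  refine (hL.dist_le_mul _ _).trans (le_of_eq ?_)
  congr 1
  rw [dist_eq_norm, dist_eq_norm, sub_sub_sub_cancel_right]

/-- The mollification by a bump of centre `c` and outer radius `R` is supported in the open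
`(‖c‖ + R)`-neighbourhood of `support G` (Mathlib's `support_convolution_subset`). [folklore] -/
theorem support_normed_convolution_subset_thickening {c : E'} (φ : ContDiffBump c) (G : E' → F) :
    support (φ.normed μ ⋆[lsmul ℝ ℝ, μ] G) ⊆ thickening (‖c‖ + φ.rOut) (support G) := by
  intro x hx
  obtain ⟨b, hb, s, hs, rfl⟩ := support_convolution_subset (lsmul ℝ ℝ) hx
  rw [φ.support_normed_eq, mem_ball, dist_eq_norm] at hb
  refine mem_thickening_iff.2 ⟨s, hs, ?_⟩
  rw [dist_eq_norm, add_sub_cancel_right]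
  calc ‖b‖ = ‖(b - c) + c‖ := by rw [sub_add_cancel]
    _ ≤ ‖b - c‖ + ‖c‖ := norm_add_le _ _
    _ < φ.rOut + ‖c‖ := by gcongr
    _ = ‖c‖ + φ.rOut := add_comm _ _

omit [NormedSpace ℝ E'] [FiniteDimensional ℝ E'] [BorelSpace E'] [μ.IsAddHaarMeasure] in
/-- Pointwise bound of a convolution by a bounded kernel in terms of the `L¹` norm:
`‖(K ⋆ h) x‖ ≤ (sup |K|) ‖h‖_{L¹}` (in `ℝ≥0∞`). [folklore] -/
theorem enorm_convolution_le_mul_lintegral [MeasurableAdd E'] [MeasurableNeg E']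
    [μ.IsAddLeftInvariant] [μ.IsNegInvariant] {K : E' → ℝ} {C : ℝ}
    (hK : ∀ y, ‖K y‖ ≤ C) (h : E' → F) (x : E') :
    ‖(K ⋆[lsmul ℝ ℝ, μ] h) x‖ₑ ≤ ENNReal.ofReal C * ∫⁻ y, ‖h y‖ₑ ∂μ := by
  refine (UnboundedOperators.enorm_convolution_lsmul_le K h x).trans ?_
  calc ∫⁻ y, ‖K y‖ₑ * ‖h (x - y)‖ₑ ∂μ ≤ ∫⁻ y, ENNReal.ofReal C * ‖h (x - y)‖ₑ ∂μ := by
        refine lintegral_mono fun y => ?_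
        gcongr
        rw [← ofReal_norm]
        exact ENNReal.ofReal_le_ofReal (hK y)
    _ = ENNReal.ofReal C * ∫⁻ y, ‖h y‖ₑ ∂μ := by
        rw [lintegral_const_mul' _ _ ENNReal.ofReal_ne_top,
          lintegral_sub_left_eq_self (fun y => ‖h y‖ₑ) x]

/-- Pointwise essential-supremum bound of a convolution by a unit-mass kernel:
`‖(K ⋆ f) x‖ ≤ ‖f‖_{L^∞}` for every `x` (the kernel is a probability density and translation
preserves null sets). [folklore] -/
theorem enorm_convolution_le_eLpNormEssSup {K : E' → ℝ} (hK : ∫⁻ y, ‖K y‖ₑ ∂μ = 1)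
    (hKm : AEStronglyMeasurable K μ) (f : E' → F) (x : E') :
    ‖(K ⋆[lsmul ℝ ℝ, μ] f) x‖ₑ ≤ eLpNormEssSup f μ := by
  refine (UnboundedOperators.enorm_convolution_lsmul_le K f x).trans ?_
  calc ∫⁻ y, ‖K y‖ₑ * ‖f (x - y)‖ₑ ∂μ ≤ ∫⁻ y, ‖K y‖ₑ * eLpNormEssSup f μ ∂μ := by
        apply lintegral_mono_ae
        filter_upwards [(quasiMeasurePreserving_sub_left_of_right_invariant μ x).ae
          (enorm_ae_le_eLpNormEssSup f μ)] with y hy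
        gcongr
    _ = eLpNormEssSup f μ := by rw [lintegral_mul_const'' _ hKm.enorm, hK, one_mul]

/-- The two mollifications `ρ ⋆ V` and `ρ ⋆ G` differ pointwise by at most
`(sup ρ) ‖V - G‖_{L¹}`. [folklore] -/
theorem enorm_normed_convolution_sub_le {c : E'} (φ : ContDiffBump c) {V G : E' → F}
    (hV : LocallyIntegrable V μ) (hG : LocallyIntegrable G μ) {C : ℝ}
    (hC : ∀ y, ‖φ.normed μ y‖ ≤ C) (x : E') :
    ‖(φ.normed μ ⋆[lsmul ℝ ℝ, μ] V) x - (φ.normed μ ⋆[lsmul ℝ ℝ, μ] G) x‖ₑ ≤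
      ENNReal.ofReal C * eLpNorm (V - G) 1 μ := by
  have hex : ∀ f : E' → F, LocallyIntegrable f μ →
      ConvolutionExistsAt (φ.normed μ) f x (lsmul ℝ ℝ) μ := fun f hf =>
    φ.hasCompactSupport_normed.convolutionExists_left _ φ.continuous_normed hf x
  have heq : (φ.normed μ ⋆[lsmul ℝ ℝ, μ] V) x - (φ.normed μ ⋆[lsmul ℝ ℝ, μ] G) x =
      (φ.normed μ ⋆[lsmul ℝ ℝ, μ] (V - G)) x := by
    have h := (hex _ (hV.sub hG)).distrib_add (hex _ hG)
    rw [sub_add_cancel] at h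
    rw [h, add_sub_cancel_right]
  rw [heq, eLpNorm_one_eq_lintegral_enorm]
  exact enorm_convolution_le_mul_lintegral hC _ x

end Kernel

/-! ## Part 2. `C¹` estimates for shifted mollification -/

section SmoothEstimates

variable {E' : Type*} [NormedAddCommGroup E'] [NormedSpace ℝ E'] [FiniteDimensional ℝ E']
  [MeasurableSpace E'] [BorelSpace E'] {μ : Measure E'} [μ.IsAddHaarMeasure]
variable {F : Type*} [NormedAddCommGroup F] [NormedSpace ℝ F] [CompleteSpace F]

/-- `(ρ ⋆ V) x - V x = ∫ ρ y (V (x - y) - V x) dy` for a unit-mass kernel and continuous `V`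
(Evans, *PDE*, §5.7, proof of Thm. 1, step 3). [folklore] -/
theorem normed_convolution_sub_self_eq {c : E'} (φ : ContDiffBump c) {V : E' → F}
    (hV : Continuous V) (x : E') :
    (φ.normed μ ⋆[lsmul ℝ ℝ, μ] V) x - V x = ∫ y, φ.normed μ y • (V (x - y) - V x) ∂μ := by
  have hρc := φ.continuous_normed (μ := μ)
  have hρcs := φ.hasCompactSupport_normed (μ := μ)
  have hint1 : Integrable (fun y => φ.normed μ y • V (x - y)) μ :=
    (hρc.smul (hV.comp (continuous_const.sub continuous_id))).integrable_of_hasCompactSupport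
      hρcs.smul_right
  have hint2 : Integrable (fun y => φ.normed μ y • V x) μ :=
    (hρc.smul continuous_const).integrable_of_hasCompactSupport hρcs.smul_right
  rw [convolution_lsmul]
  simp_rw [smul_sub]
  rw [integral_sub hint1 hint2, integral_smul_const, φ.integral_normed, one_smul]

omit [MeasurableSpace E'] [BorelSpace E'] [FiniteDimensional ℝ E'] [CompleteSpace F] in
/-- Mean value inequality along the segment from `x` to `x - s`: if `‖DV‖ ≤ L` at all points
`x - θ s`, `θ ∈ [0,1]`, then `‖V (x - s) - V x‖ ≤ L ‖s‖`. [folklore] -/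
theorem norm_sub_le_of_fderiv_le_segment {V : E' → F} (hV : Differentiable ℝ V) {L : ℝ}
    (x s : E') (hL : ∀ θ ∈ Icc (0:ℝ) 1, ‖fderiv ℝ V (x - θ • s)‖ ≤ L) :
    ‖V (x - s) - V x‖ ≤ L * ‖s‖ := by
  have hseg : ∀ z ∈ segment ℝ x (x - s), ‖fderiv ℝ V z‖ ≤ L := by
    intro z hz
    rw [segment_eq_image'] at hz
    obtain ⟨θ, hθ, rfl⟩ := hz
    have : x + θ • (x - s - x) = x - θ • s := by
      rw [sub_sub_cancel_left, smul_neg, ← sub_eq_add_neg]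
    show ‖fderiv ℝ V (x + θ • (x - s - x))‖ ≤ L
    rw [this]
    exact hL θ hθ
  have h := (convex_segment x (x - s)).norm_image_sub_le_of_norm_fderiv_le (𝕜 := ℝ)
    (fun z _ => hV z) hseg (left_mem_segment ℝ x (x - s)) (right_mem_segment ℝ x (x - s))
  rwa [sub_sub_cancel_left, norm_neg] at h

/-- **Sup-norm mollification error for `C¹` functions** with a shifted kernel: if
`‖DV‖ ≤ L` on all segments `[x - s, x]`, `s` in the kernel support `closedBall c R`, then
`‖(ρ ⋆ V) x - V x‖ ≤ (‖c‖ + R) L` (Evans, *PDE*, §5.7, proof of Thm. 1, step 3, sup form).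
[folklore] -/
theorem norm_normed_convolution_sub_self_le {c : E'} (φ : ContDiffBump c) {V : E' → F}
    (hV : ContDiff ℝ 1 V) {L : ℝ} (hL0 : 0 ≤ L) (x : E')
    (hL : ∀ s ∈ closedBall c φ.rOut, ∀ θ ∈ Icc (0:ℝ) 1, ‖fderiv ℝ V (x - θ • s)‖ ≤ L) :
    ‖(φ.normed μ ⋆[lsmul ℝ ℝ, μ] V) x - V x‖ ≤ (‖c‖ + φ.rOut) * L := by
  have hd : Differentiable ℝ V := hV.differentiable one_ne_zero
  rw [normed_convolution_sub_self_eq φ hV.continuous x]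
  have key : ∀ s, ‖φ.normed μ s • (V (x - s) - V x)‖ ≤ φ.normed μ s * ((‖c‖ + φ.rOut) * L) := by
    intro s
    rw [norm_smul, Real.norm_of_nonneg (φ.nonneg_normed _)]
    by_cases hs : s ∈ closedBall c φ.rOut
    · refine mul_le_mul_of_nonneg_left ?_ (φ.nonneg_normed _)
      calc ‖V (x - s) - V x‖ ≤ L * ‖s‖ := norm_sub_le_of_fderiv_le_segment hd x s (hL s hs)
        _ ≤ L * (‖c‖ + φ.rOut) := by gcongr; exact norm_le_of_mem_closedBall hs
        _ = (‖c‖ + φ.rOut) * L := mul_comm _ _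
    · have h0 : φ.normed μ s = 0 := by
        rw [← notMem_support, φ.support_normed_eq]
        exact fun h => hs (ball_subset_closedBall h)
      rw [h0, zero_mul, zero_mul]
  calc ‖∫ y, φ.normed μ y • (V (x - y) - V x) ∂μ‖
        ≤ ∫ y, φ.normed μ y * ((‖c‖ + φ.rOut) * L) ∂μ :=
          norm_integral_le_of_norm_le (φ.integrable_normed.mul_const _) (ae_of_all _ key)
    _ = (‖c‖ + φ.rOut) * L := by rw [integral_mul_const, φ.integral_normed, one_mul]

/-- **`L^q` mollification error for `C¹` functions on a region, shifted kernel** (the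
integrated form of Evans, *PDE*, §5.7, proof of Thm. 1, step 3, resp. Adams 1975, proof of
Thm. 2.21, display (25), localised): if a measurable `H` dominates `‖DV‖` at all points
`x - θ s` (`x ∈ S`, `s ∈ closedBall c R`, `θ ∈ [0,1]`), then
`∫_S ‖ρ ⋆ V - V‖^q ≤ (‖c‖ + R)^q ∫ H^q` for `1 ≤ q`. Proof: Jensen for the probability measure
`ρ dμ`, the fundamental theorem of calculus along segments with Jensen on `[0,1]`, Tonelli and
translation invariance. [folklore] -/
theorem lintegral_enorm_normed_convolution_sub_self_rpow_le {c : E'} (φ : ContDiffBump c)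
    {V : E' → F} (hV : ContDiff ℝ 1 V) {S : Set E'} (hS : MeasurableSet S) {H : E' → ℝ≥0∞}
    (hH : Measurable H)
    (hSH : ∀ x ∈ S, ∀ s ∈ closedBall c φ.rOut, ∀ θ ∈ Icc (0:ℝ) 1,
      ‖fderiv ℝ V (x - θ • s)‖ₑ ≤ H (x - θ • s))
    {q : ℝ} (hq : 1 ≤ q) :
    ∫⁻ x in S, ‖(φ.normed μ ⋆[lsmul ℝ ℝ, μ] V) x - V x‖ₑ ^ q ∂μ ≤
      ENNReal.ofReal (‖c‖ + φ.rOut) ^ q * ∫⁻ y, H y ^ q ∂μ := by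
  have hq0 : 0 ≤ q := by linarith
  set ρN : E' → ℝ := φ.normed μ with hρN
  have hρi : ∫ y, ρN y ∂μ = 1 := φ.integral_normed
  have hρnn : ∀ y, 0 ≤ ρN y := φ.nonneg_normed
  have hρc : Continuous ρN := φ.continuous_normed
  have hρint : Integrable ρN μ := φ.integrable_normed
  -- Step 1: pointwise bound by the kernel-weighted increments
  have h1 : ∀ x, ‖(ρN ⋆[lsmul ℝ ℝ, μ] V) x - V x‖ₑ ≤
      ∫⁻ y, ENNReal.ofReal (ρN y) * ‖V (x - y) - V x‖ₑ ∂μ := by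
    intro x
    rw [hρN, normed_convolution_sub_self_eq φ hV.continuous x]
    refine (enorm_integral_le_lintegral_enorm _).trans (le_of_eq (lintegral_congr fun y => ?_))
    rw [enorm_smul, Real.enorm_eq_ofReal (hρnn y)]
  -- Step 2: the increments are bounded by `Φ x s = ∫₀¹ H (x - θ s) ‖s‖ dθ` on the support
  set ν₁ : Measure ℝ := volume.restrict (Ioc (0:ℝ) 1) with hν₁
  haveI : IsProbabilityMeasure ν₁ := ⟨by simp [ν₁]⟩
  set Φ : E' → E' → ℝ≥0∞ := fun x s => ∫⁻ θ, H (x - θ • s) * ‖s‖ₑ ∂ν₁ with hΦ_def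
  have hΦm : Measurable (uncurry Φ) := by
    have hf : Measurable fun w : (E' × E') × ℝ => H (w.1.1 - w.2 • w.1.2) * ‖w.1.2‖ₑ :=
      (hH.comp (by fun_prop)).mul (by fun_prop)
    exact hf.lintegral_prod_right'
  have h2 : ∀ x ∈ S, ∀ s, ENNReal.ofReal (ρN s) * ‖V (x - s) - V x‖ₑ ≤
      ENNReal.ofReal (ρN s) * Φ x s := by
    intro x hx s
    by_cases hs : s ∈ closedBall c φ.rOut
    · gcongr
      calc ‖V (x - s) - V x‖ₑ ≤ ∫⁻ θ in Ioc (0:ℝ) 1, ‖fderiv ℝ V (x - θ • s)‖ₑ * ‖s‖ₑ :=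
            enorm_sub_le_lintegral_fderiv hV x s
        _ ≤ ∫⁻ θ in Ioc (0:ℝ) 1, H (x - θ • s) * ‖s‖ₑ := by
            refine lintegral_mono_ae ?_
            filter_upwards [ae_restrict_mem measurableSet_Ioc] with θ hθ
            gcongr
            exact hSH x hx s hs θ ⟨hθ.1.le, hθ.2⟩
        _ = Φ x s := rfl
    · have h0 : ρN s = 0 := by
        rw [← notMem_support, hρN, φ.support_normed_eq]
        exact fun h => hs (ball_subset_closedBall h)
      simp [h0]
  -- Step 3: the probability measure `ρN dμ`
  have hρm : Measurable fun y => ENNReal.ofReal (ρN y) :=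
    ENNReal.measurable_ofReal.comp hρc.measurable
  have hlin : ∫⁻ y, ENNReal.ofReal (ρN y) ∂μ = 1 := by
    rw [← ofReal_integral_eq_lintegral_ofReal hρint (ae_of_all _ hρnn), hρi, ENNReal.ofReal_one]
  set ν : Measure E' := μ.withDensity fun y => ENNReal.ofReal (ρN y) with hν
  haveI : IsProbabilityMeasure ν :=
    ⟨by rw [hν, withDensity_apply _ MeasurableSet.univ, Measure.restrict_univ, hlin]⟩
  set D : ℝ≥0∞ := ∫⁻ y, H y ^ q ∂μ with hD
  -- Step 4: for fixed `s`, `∫_S Φ(x,s)^q dx ≤ ‖s‖^q D`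
  have h4 : ∀ s, ∫⁻ x in S, Φ x s ^ q ∂μ ≤ ‖s‖ₑ ^ q * D := by
    intro s
    set G : E' → ℝ → ℝ≥0∞ := fun x θ => H (x - θ • s) * ‖s‖ₑ with hG_def
    have hG : Measurable (uncurry G) := by
      have : Measurable fun w : E' × ℝ => H (w.1 - w.2 • s) * ‖s‖ₑ :=
        (hH.comp (by fun_prop)).mul measurable_const
      exact this
    have hm : Measurable fun z => H z ^ q := hH.pow_const q
    calc ∫⁻ x in S, Φ x s ^ q ∂μ = ∫⁻ x in S, (∫⁻ θ, G x θ ∂ν₁) ^ q ∂μ := rfl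
      _ ≤ ∫⁻ θ, ∫⁻ x in S, G x θ ^ q ∂μ ∂ν₁ := lintegral_rpow_lintegral_le hG hq
      _ ≤ ∫⁻ θ, ∫⁻ x, G x θ ^ q ∂μ ∂ν₁ :=
          lintegral_mono fun θ => lintegral_mono' Measure.restrict_le_self le_rfl
      _ = ∫⁻ θ, D * ‖s‖ₑ ^ q ∂ν₁ := by
          refine lintegral_congr fun θ => ?_
          have e1 : (fun x => G x θ ^ q) = fun x => (fun z => H z ^ q * ‖s‖ₑ ^ q) (x - θ • s) := by
            funext x
            exact ENNReal.mul_rpow_of_nonneg _ _ hq0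
          rw [e1, lintegral_sub_right_eq_self (fun z => H z ^ q * ‖s‖ₑ ^ q) (θ • s),
            lintegral_mul_const _ hm]
      _ = ‖s‖ₑ ^ q * D := by rw [lintegral_const, measure_univ, mul_one, mul_comm]
  -- Step 5: assemble
  calc ∫⁻ x in S, ‖(ρN ⋆[lsmul ℝ ℝ, μ] V) x - V x‖ₑ ^ q ∂μ
        ≤ ∫⁻ x in S, (∫⁻ s, Φ x s ∂ν) ^ q ∂μ := by
          refine setLIntegral_mono' hS fun x hx => ENNReal.rpow_le_rpow ?_ hq0
          calc ‖(ρN ⋆[lsmul ℝ ℝ, μ] V) x - V x‖ₑ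
                ≤ ∫⁻ y, ENNReal.ofReal (ρN y) * ‖V (x - y) - V x‖ₑ ∂μ := h1 x
            _ ≤ ∫⁻ y, ENNReal.ofReal (ρN y) * Φ x y ∂μ := lintegral_mono fun y => h2 x hx y
            _ = ∫⁻ s, Φ x s ∂ν := by
                rw [hν, lintegral_withDensity_eq_lintegral_mul μ hρm hΦm.of_uncurry_left]
                rfl
    _ ≤ ∫⁻ s, ∫⁻ x in S, Φ x s ^ q ∂μ ∂ν := lintegral_rpow_lintegral_le hΦm hq
    _ ≤ ∫⁻ s, ‖s‖ₑ ^ q * D ∂ν := lintegral_mono fun s => h4 s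
    _ = ∫⁻ s, ENNReal.ofReal (ρN s) * (‖s‖ₑ ^ q * D) ∂μ := by
          rw [hν, lintegral_withDensity_eq_lintegral_mul μ hρm
            ((continuous_enorm.measurable.pow_const q).mul_const D)]
          rfl
    _ ≤ ∫⁻ s, ENNReal.ofReal (ρN s) * (ENNReal.ofReal (‖c‖ + φ.rOut) ^ q * D) ∂μ := by
          refine lintegral_mono fun s => ?_
          by_cases hs : s ∈ closedBall c φ.rOut
          · gcongr
            rw [← ofReal_norm]
            exact ENNReal.ofReal_le_ofReal (norm_le_of_mem_closedBall hs)
          · have h0 : ρN s = 0 := by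
              rw [← notMem_support, hρN, φ.support_normed_eq]
              exact fun h => hs (ball_subset_closedBall h)
            rw [h0]
            simp
    _ = ENNReal.ofReal (‖c‖ + φ.rOut) ^ q * D := by
          rw [lintegral_mul_const _ hρm, hlin, one_mul]

end SmoothEstimates

/-! ## Part 3. Mollification error for weakly differentiable functions, `1 ≤ p ≤ ∞` -/

section WeakEstimate

variable {E' : Type*} [NormedAddCommGroup E'] [NormedSpace ℝ E'] [FiniteDimensional ℝ E']
  [MeasurableSpace E'] [BorelSpace E'] {μ : Measure E'} [μ.IsAddHaarMeasure]
variable {F : Type*} [NormedAddCommGroup F] [NormedSpace ℝ F] [CompleteSpace F]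

/-- The reflected support of a bump of centre `c'` at the point `y` is `closedBall (y - c') r`:
if that ball lies in `Ω` then `y - z ∈ Ω` for all `z ∈ tsupport (ρ.normed μ)`. [folklore] -/
theorem sub_mem_of_closedBall_sub_subset {Ω : Set E'} {c' y : E'} (φ' : ContDiffBump c')
    (hy : closedBall (y - c') φ'.rOut ⊆ Ω) :
    ∀ z ∈ tsupport (φ'.normed μ), y - z ∈ Ω := by
  intro z hz
  rw [φ'.tsupport_normed_eq] at hz
  refine hy (mem_closedBall.2 ?_)
  rw [dist_eq_norm, sub_sub_sub_cancel_left, ← dist_eq_norm, dist_comm]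
  exact mem_closedBall.1 hz

/-- **Mollification error for weakly differentiable functions, shifted kernel, `1 ≤ p ≤ ∞`.**
Let `g` be a weak derivative of `G` on `Ω` (`G ∈ L¹(μ)`, `g ∈ L¹_loc(μ)` globally — the zero
extensions in the application), `ρ` a bump of centre `c` and outer radius `R`, and `S` a
measurable set such that for `x ∈ S`, `s ∈ closedBall c R`, `θ ∈ [0,1]` the reflected supports
`closedBall (x - θ s - c'ₖ) r'ₖ` of an approximate identity `ρ'ₖ` (centres `c'ₖ → 0`, radii
`r'ₖ → 0`) stay inside `Ω`. Then `‖ρ ⋆ G - G‖_{L^p(S)} ≤ (‖c‖ + R) ‖g‖_{L^p(μ)}`.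
This is the estimate `‖u^ε_m - u_m‖_{L^q(V)} ≤ ε ‖Du_m‖_{L^q}` of Evans, *PDE*, §5.7, proof of
Thm. 1, step 3 (there for the extensions `u_m ∈ W^{1,q}(ℝⁿ)`, via smooth approximation), resp.
the translation estimate (16) of Adams, *Sobolev Spaces* (1975), §6.7, proof of Thm. 6.2
(there via density of `C^∞(Ω)`), proved here without extension or density theorem:
`Vₖ = ρ'ₖ ⋆ G → G` in `L¹` hence a.e. along a subsequence, `ρ ⋆ Vₖ → ρ ⋆ G` everywhere,
`DVₖ = ρ'ₖ ⋆ g` on the relevant region (mollification commutes with weak differentiation,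
`SobolevApprox.hasFDerivAt_convolution_of_tsupport_subset`), the `C¹` estimates
(`lintegral_enorm_normed_convolution_sub_self_rpow_le` for `p < ∞` with Fatou's lemma;
`norm_normed_convolution_sub_self_le` for `p = ∞`) and Young's inequality
`‖ρ'ₖ ⋆ g‖_p ≤ ‖g‖_p`. [cite: Evans2010, §5.7 proof of Theorem 1, step 3] -/
theorem eLpNorm_normed_convolution_sub_self_le_of_hasWeakFDerivOn
    {Ω : Opens E'} {G : E' → F} {g : E' → E' →L[ℝ] F} (hw : HasWeakFDerivOn Ω μ G g)
    (hG : Integrable G μ) (hg : LocallyIntegrable g μ) {c : E'} (φ : ContDiffBump c)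
    {c' : ℕ → E'} (φ' : ∀ k, ContDiffBump (c' k)) (hc' : Tendsto c' atTop (𝓝 0))
    (hr' : Tendsto (fun k => (φ' k).rOut) atTop (𝓝 0)) {S : Set E'} (hS : MeasurableSet S)
    (hgeo : ∀ x ∈ S, ∀ s ∈ closedBall c φ.rOut, ∀ θ ∈ Icc (0:ℝ) 1, ∀ k,
      closedBall (x - θ • s - c' k) (φ' k).rOut ⊆ (Ω : Set E'))
    {p : ℝ≥0∞} (hp : 1 ≤ p) :
    eLpNorm (fun x => (φ.normed μ ⋆[lsmul ℝ ℝ, μ] G) x - G x) p (μ.restrict S) ≤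
      ENNReal.ofReal (‖c‖ + φ.rOut) * eLpNorm g p μ := by
  set K : E' → ℝ := φ.normed μ with hK
  set V : ℕ → E' → F := fun k => (φ' k).normed μ ⋆[lsmul ℝ ℝ, μ] G with hV_def
  set W : ℕ → E' → (E' →L[ℝ] F) := fun k => (φ' k).normed μ ⋆[lsmul ℝ ℝ, μ] g with hW_def
  have hGloc : LocallyIntegrable G μ := hG.locallyIntegrable
  have hVs : ∀ k, ContDiff ℝ 1 (V k) := fun k =>
    (φ' k).hasCompactSupport_normed.contDiff_convolution_left _ (φ' k).contDiff_normed hGloc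
  have hVc : ∀ k, Continuous (V k) := fun k => (hVs k).continuous
  have hVloc : ∀ k, LocallyIntegrable (V k) μ := fun k => (hVc k).locallyIntegrable
  have hWc : ∀ k, Continuous (W k) := fun k =>
    (φ' k).hasCompactSupport_normed.continuous_convolution_left _ (φ' k).continuous_normed hg
  have hKVc : ∀ k, Continuous (K ⋆[lsmul ℝ ℝ, μ] V k) := fun k =>
    φ.hasCompactSupport_normed.continuous_convolution_left _ φ.continuous_normed (hVloc k)
  -- derivative of `V k` on the good region
  have hDV : ∀ k y, closedBall (y - c' k) (φ' k).rOut ⊆ (Ω : Set E') →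
      fderiv ℝ (V k) y = W k y := fun k y hy =>
    (SobolevApprox.hasFDerivAt_convolution_of_tsupport_subset hw hGloc hg (φ' k).contDiff_normed
      (φ' k).hasCompactSupport_normed (sub_mem_of_closedBall_sub_subset (φ' k) hy)).fderiv
  -- unit mass of the kernels
  have hmass : ∀ k, ∫⁻ y, ‖(φ' k).normed μ y‖ₑ ∂μ = 1 := fun k =>
    SobolevApprox.lintegral_enorm_eq_one_of_nonneg (φ' k).nonneg_normed (φ' k).integral_normed
  -- `V k → G` in `L¹`, hence a.e. along a subsequence
  have hG1 : MemLp G 1 μ := memLp_one_iff_integrable.2 hG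
  have hL1 : Tendsto (fun k => eLpNorm (V k - G) 1 μ) atTop (𝓝 0) :=
    SobolevApprox.tendsto_eLpNorm_normed_convolution_sub_self φ' hc' hr' le_rfl ENNReal.one_ne_top hG1
  have hVm : ∀ k, AEStronglyMeasurable (V k) μ := fun k => (hVc k).aestronglyMeasurable
  obtain ⟨ns, hns, hae⟩ := (tendstoInMeasure_of_tendsto_eLpNorm one_ne_zero hVm
    hG.aestronglyMeasurable hL1).exists_seq_tendsto_ae
  -- `K ⋆ V k → K ⋆ G` everywhere
  obtain ⟨CK, hCK⟩ := (φ.continuous_normed (μ := μ)).bounded_above_of_compact_support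
    (φ.hasCompactSupport_normed (μ := μ))
  have hKconv : ∀ x, Tendsto (fun k => (K ⋆[lsmul ℝ ℝ, μ] V k) x) atTop
      (𝓝 ((K ⋆[lsmul ℝ ℝ, μ] G) x)) := by
    intro x
    rw [tendsto_iff_edist_tendsto_0]
    refine tendsto_of_tendsto_of_tendsto_of_le_of_le tendsto_const_nhds
      (?_ : Tendsto (fun k => ENNReal.ofReal CK * eLpNorm (V k - G) 1 μ) atTop (𝓝 0))
      (fun k => bot_le) fun k => ?_
    · have := ENNReal.Tendsto.const_mul hL1 (a := ENNReal.ofReal CK) (Or.inr ENNReal.ofReal_ne_top)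
      rwa [mul_zero] at this
    · rw [edist_eq_enorm_sub]
      exact enorm_normed_convolution_sub_le φ (hVloc k) hGloc hCK x
  -- hence a.e. `‖K ⋆ G - G‖ = lim ‖K ⋆ V_{ns i} - V_{ns i}‖`
  have hlim : ∀ᵐ x ∂μ, Tendsto (fun i => ‖(K ⋆[lsmul ℝ ℝ, μ] V (ns i)) x - V (ns i) x‖ₑ) atTop
      (𝓝 ‖(K ⋆[lsmul ℝ ℝ, μ] G) x - G x‖ₑ) := by
    filter_upwards [hae] with x hx
    exact (continuous_enorm.tendsto _).comp (((hKconv x).comp hns.tendsto_atTop).sub hx)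
  have hcR : 0 < ‖c‖ + φ.rOut := add_pos_of_nonneg_of_pos (norm_nonneg _) φ.rOut_pos
  by_cases hpt : p = (⊤ : ℝ≥0∞)
  · -- `p = ∞`: pointwise bounds
    subst hpt
    rcases eq_or_ne (eLpNorm g ⊤ μ) ⊤ with hgt | hgt
    · rw [hgt, ENNReal.mul_top (by simpa using hcR)]
      exact le_top
    set L : ℝ := (eLpNorm g ⊤ μ).toReal with hL
    have hWL : ∀ k y, ‖W k y‖ ≤ L := fun k y => by
      have h := enorm_convolution_le_eLpNormEssSup (hmass k)
        (φ' k).continuous_normed.aestronglyMeasurable g y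
      rw [← eLpNorm_exponent_top] at h
      rw [← toReal_enorm, hL]
      exact (ENNReal.toReal_le_toReal enorm_ne_top hgt).2 h
    have hL0 : 0 ≤ L := ENNReal.toReal_nonneg
    have hbound : ∀ k, ∀ x ∈ S, ‖(K ⋆[lsmul ℝ ℝ, μ] V k) x - V k x‖ ≤ (‖c‖ + φ.rOut) * L :=
      fun k x hx => norm_normed_convolution_sub_self_le φ (hVs k) hL0 x fun s hs θ hθ => by
        rw [hDV k _ (hgeo x hx s hs θ hθ k)]
        exact hWL k _
    have hae' : ∀ᵐ x ∂μ.restrict S, ‖(K ⋆[lsmul ℝ ℝ, μ] G) x - G x‖ₑ ≤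
        ENNReal.ofReal ((‖c‖ + φ.rOut) * L) := by
      filter_upwards [ae_restrict_of_ae hlim, ae_restrict_mem hS] with x hx hxS
      refine le_of_tendsto' hx fun i => ?_
      rw [← ofReal_norm]
      exact ENNReal.ofReal_le_ofReal (hbound _ x hxS)
    calc eLpNorm (fun x => (K ⋆[lsmul ℝ ℝ, μ] G) x - G x) ⊤ (μ.restrict S)
          ≤ ENNReal.ofReal ((‖c‖ + φ.rOut) * L) := by
            rw [eLpNorm_exponent_top]
            exact eLpNormEssSup_le_of_ae_enorm_bound hae'
      _ = ENNReal.ofReal (‖c‖ + φ.rOut) * eLpNorm g ⊤ μ := by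
            rw [ENNReal.ofReal_mul hcR.le, hL, ENNReal.ofReal_toReal hgt]
  · -- `p < ∞`: Fatou
    have hp0 : p ≠ 0 := (zero_lt_one.trans_le hp).ne'
    have hq : 1 ≤ p.toReal := by
      rw [← ENNReal.toReal_one]; exact ENNReal.toReal_mono hpt hp
    have hq0 : 0 < p.toReal := one_pos.trans_le hq
    rw [eLpNorm_eq_lintegral_rpow_enorm_toReal hp0 hpt, eLpNorm_eq_lintegral_rpow_enorm_toReal hp0 hpt]
    suffices h : ∫⁻ x in S, ‖(K ⋆[lsmul ℝ ℝ, μ] G) x - G x‖ₑ ^ p.toReal ∂μ ≤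
        ENNReal.ofReal (‖c‖ + φ.rOut) ^ p.toReal * ∫⁻ x, ‖g x‖ₑ ^ p.toReal ∂μ by
      calc (∫⁻ x in S, ‖(K ⋆[lsmul ℝ ℝ, μ] G) x - G x‖ₑ ^ p.toReal ∂μ) ^ (1 / p.toReal)
            ≤ (ENNReal.ofReal (‖c‖ + φ.rOut) ^ p.toReal * ∫⁻ x, ‖g x‖ₑ ^ p.toReal ∂μ) ^
                (1 / p.toReal) := ENNReal.rpow_le_rpow h (by positivity)
        _ = ENNReal.ofReal (‖c‖ + φ.rOut) * (∫⁻ x, ‖g x‖ₑ ^ p.toReal ∂μ) ^ (1 / p.toReal) := by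
            rw [ENNReal.mul_rpow_of_nonneg _ _ (by positivity), ← ENNReal.rpow_mul,
              mul_one_div_cancel hq0.ne', ENNReal.rpow_one]
    -- the bound for each smooth `V (ns i)`
    have hFk : ∀ i, ∫⁻ x in S, ‖(K ⋆[lsmul ℝ ℝ, μ] V (ns i)) x - V (ns i) x‖ₑ ^ p.toReal ∂μ ≤
        ENNReal.ofReal (‖c‖ + φ.rOut) ^ p.toReal * ∫⁻ x, ‖g x‖ₑ ^ p.toReal ∂μ := by
      intro i
      refine (lintegral_enorm_normed_convolution_sub_self_rpow_le φ (hVs _) hS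
        (H := fun y => ‖W (ns i) y‖ₑ) (continuous_enorm.comp (hWc _)).measurable
        (fun x hx s hs θ hθ => ?_)
        hq).trans ?_
      · rw [hDV _ _ (hgeo x hx s hs θ hθ _)]
      · gcongr ?_ * ?_
        · exact le_rfl
        have h := UnboundedOperators.lintegral_rpow_enorm_convolution_le (μ := μ) (K := (φ' (ns i)).normed μ)
          (φ' (ns i)).continuous_normed.aestronglyMeasurable hg.aestronglyMeasurable hq
        rw [hmass, ENNReal.one_rpow, one_mul] at h
        exact h
    have hmeas : ∀ i, AEMeasurable
        (fun x => ‖(K ⋆[lsmul ℝ ℝ, μ] V (ns i)) x - V (ns i) x‖ₑ ^ p.toReal) (μ.restrict S) :=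
      fun i => ((hKVc _).sub (hVc _)).aestronglyMeasurable.enorm.pow_const _
    calc ∫⁻ x in S, ‖(K ⋆[lsmul ℝ ℝ, μ] G) x - G x‖ₑ ^ p.toReal ∂μ
          = ∫⁻ x in S, liminf (fun i => ‖(K ⋆[lsmul ℝ ℝ, μ] V (ns i)) x - V (ns i) x‖ₑ ^ p.toReal)
              atTop ∂μ := by
            refine lintegral_congr_ae ?_
            filter_upwards [ae_restrict_of_ae hlim] with x hx
            exact (((ENNReal.continuous_rpow_const.tendsto _).comp hx).liminf_eq).symm
      _ ≤ liminf (fun i => ∫⁻ x in S, ‖(K ⋆[lsmul ℝ ℝ, μ] V (ns i)) x - V (ns i) x‖ₑ ^ p.toReal ∂μ)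
            atTop := lintegral_liminf_le' hmeas
      _ ≤ ENNReal.ofReal (‖c‖ + φ.rOut) ^ p.toReal * ∫⁻ x, ‖g x‖ₑ ^ p.toReal ∂μ :=
            liminf_le_of_frequently_le (Eventually.of_forall hFk).frequently

end WeakEstimate

/-! ## Part 4. Geometry of the patches -/

section Geometry

variable {E' : Type*} [NormedAddCommGroup E'] [InnerProductSpace ℝ E']

/-- Norm of a point of the kernel support `closedBall (-(t • u)) R`, `‖u‖ ≤ 1`, `0 ≤ t`:
at most `t + R`. [folklore] -/
theorem norm_le_of_mem_closedBall_neg_smul {u s : E'} (hu : ‖u‖ ≤ 1) {t R : ℝ} (ht : 0 ≤ t)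
    (hs : s ∈ closedBall (-(t • u)) R) : ‖s‖ ≤ t + R := by
  have h := norm_le_of_mem_closedBall hs
  rw [norm_neg, norm_smul, Real.norm_of_nonneg ht] at h
  nlinarith [norm_nonneg u]

/-- **Boundary patches: the kernel supports along segments stay in `Ω`** (the cone property
of a Lipschitz epigraph, `SobolevApprox.closedBall_add_smul_subset_of_graph`, applied twice:
Evans, *PDE*, §5.3.3, proof of Theorem 3, step 1). Inside `B(x₀, r)` let `Ω` be the strict
epigraph of a `K`-Lipschitz function in the unit direction `u`; let `x ∈ Ω`,
`dist x x₀ < 5r/8`, shifts `t, t'` and radii `R, R'` with `(1 + K) R ≤ t`, `t + R ≤ r/8` (and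
likewise primed). Then for `s ∈ closedBall (-(t u)) R` and `θ ∈ [0,1]` the ball
`closedBall (x - θ s + t' u) R'` lies in `Ω`. [cite: Evans2010, §5.3.3 Theorem 3 (proof, step 1)] -/
theorem closedBall_sub_smul_sub_subset_of_graph {Ω : Set E'} {x₀ : E'} {r : ℝ} {u : E'}
    (hu : ‖u‖ = 1) {γ : E' → ℝ} {K : ℝ≥0} (hγ : LipschitzWith K γ)
    (hΩ : Ω ∩ ball x₀ r = {y | y ∈ ball x₀ r ∧ γ (y - ⟪y, u⟫_ℝ • u) < ⟪y, u⟫_ℝ})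
    {x : E'} (hx : x ∈ Ω) (hx' : dist x x₀ < 5 * r / 8)
    {t R t' R' : ℝ} (hR : 0 ≤ R) (hKR : (1 + K) * R ≤ t) (htR : t + R ≤ r / 8)
    (hR' : 0 ≤ R') (hKR' : (1 + K) * R' ≤ t') (htR' : t' + R' ≤ r / 8)
    {s : E'} (hs : s ∈ closedBall (-(t • u)) R) {θ : ℝ} (hθ : θ ∈ Icc (0:ℝ) 1) :
    closedBall (x - θ • s - (-(t' • u))) R' ⊆ Ω := by
  have hr : 0 < r := by linarith [dist_nonneg (x := x) (y := x₀)]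
  have ht0 : 0 ≤ t := le_trans (by positivity) hKR
  have hsn : ‖s‖ ≤ t + R := norm_le_of_mem_closedBall_neg_smul hu.le ht0 hs
  -- the intermediate point `y = x - θ s` lies in `Ω`
  have hy_ball : x - θ • s ∈ closedBall (x + (θ * t) • u) (θ * R) := by
    rw [mem_closedBall, dist_eq_norm]
    have e : x - θ • s - (x + (θ * t) • u) = -(θ • (s - (-(t • u)))) := by
      rw [sub_neg_eq_add, mul_smul, smul_add]; abel
    rw [e, norm_neg, norm_smul, Real.norm_of_nonneg hθ.1]
    refine mul_le_mul_of_nonneg_left ?_ hθ.1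
    rwa [mem_closedBall, dist_eq_norm] at hs
  have hyΩ : x - θ • s ∈ Ω := by
    refine SobolevApprox.closedBall_add_smul_subset_of_graph hu hγ hΩ hx (by linarith)
      (mul_nonneg hθ.1 hR) ?_ ?_ hy_ball
    · nlinarith [hθ.1, hθ.2]
    · nlinarith [hθ.1, hθ.2, K.coe_nonneg]
  have hy' : dist (x - θ • s) x₀ < 3 * r / 4 := by
    calc dist (x - θ • s) x₀ ≤ dist (x - θ • s) x + dist x x₀ := dist_triangle _ _ _
      _ = θ * ‖s‖ + dist x x₀ := by
          rw [dist_eq_norm, sub_sub_cancel_left, norm_neg, norm_smul, Real.norm_of_nonneg hθ.1]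
      _ ≤ 1 * (t + R) + dist x x₀ := by gcongr; exact hθ.2
      _ < 1 * (r / 8) + 5 * r / 8 := by linarith
      _ = 3 * r / 4 := by ring
  have h := SobolevApprox.closedBall_add_smul_subset_of_graph hu hγ hΩ hyΩ hy' hR' (by linarith)
    hKR'
  rwa [sub_neg_eq_add]

/-- Boundary patches: far from the chart centre the kernel supports miss the half-ball
carrying the cut-off: if `dist x x₀ ≥ 5r/8`, `t + R ≤ r/8` and `s ∈ closedBall (-(t u)) R`,
then `x - s ∉ B(x₀, r/2)`. [folklore] -/
theorem sub_notMem_ball_of_far {x₀ x u : E'} (hu : ‖u‖ = 1) {r t R : ℝ} (ht0 : 0 ≤ t)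
    (htR : t + R ≤ r / 8) (hx' : ¬dist x x₀ < 5 * r / 8) {s : E'}
    (hs : s ∈ closedBall (-(t • u)) R) : x - s ∉ ball x₀ (r / 2) := by
  intro h
  rw [mem_ball] at h
  apply hx'
  have hsn : ‖s‖ ≤ t + R := norm_le_of_mem_closedBall_neg_smul hu.le ht0 hs
  calc dist x x₀ ≤ dist x (x - s) + dist (x - s) x₀ := dist_triangle _ _ _
    _ = ‖s‖ + dist (x - s) x₀ := by rw [dist_eq_norm, sub_sub_cancel]
    _ < (t + R) + r / 2 := by linarith
    _ ≤ 5 * r / 8 := by linarith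

/-- **Interior patch: the kernel supports along segments stay in `Ω`.** If the closed
`d`-neighbourhood of `T` lies in `Ω`, `x` is within `d/2` of `T`, and the radii satisfy
`R, R' ≤ d/4`, then `closedBall (x - θ s) R' ⊆ Ω` for `‖s‖ ≤ R`, `θ ∈ [0,1]`
(Adams 1975, Lemma 3.15: mollification with `ε < dist(·, ∂Ω)`). [folklore] -/
theorem closedBall_sub_smul_subset_of_cthickening {T Ω : Set E'} {d : ℝ} (hd : 0 < d)
    (hT : cthickening d T ⊆ Ω) {x : E'} (hx : x ∈ cthickening (d / 2) T) {τ τ' R R' : ℝ}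
    (hR : R ≤ d / 4) (hR' : R' ≤ d / 4) {s : E'} (hs : s ∈ closedBall (-(τ • (0 : E'))) R)
    {θ : ℝ} (hθ : θ ∈ Icc (0:ℝ) 1) : closedBall (x - θ • s - (-(τ' • (0 : E')))) R' ⊆ Ω := by
  rw [smul_zero, neg_zero] at hs
  rw [smul_zero, neg_zero, sub_zero]
  intro z hz
  refine hT ?_
  have hsn : ‖s‖ ≤ R := by simpa using hs
  have h1 : z ∈ closedBall x (d / 2) := by
    rw [mem_closedBall] at hz ⊢
    calc dist z x ≤ dist z (x - θ • s) + dist (x - θ • s) x := dist_triangle _ _ _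
      _ ≤ R' + θ * ‖s‖ := by
          gcongr
          rw [dist_eq_norm, sub_sub_cancel_left, norm_neg, norm_smul, Real.norm_of_nonneg hθ.1]
      _ ≤ R' + 1 * R := by gcongr; exact hθ.2
      _ ≤ d / 2 := by linarith
  have h2 : closedBall x (d / 2) ⊆ cthickening d T :=
    calc closedBall x (d / 2) ⊆ cthickening (d / 2) (cthickening (d / 2) T) :=
          closedBall_subset_cthickening hx _
      _ ⊆ cthickening (d / 2 + d / 2) T := cthickening_cthickening_subset (by linarith) (by linarith) _
      _ = cthickening d T := by rw [add_halves]
  exact h2 h1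

/-- Interior patch: far from `T` the kernel supports miss `T`: if `x ∉ cthickening (d/2) T`
and `‖s‖ ≤ R ≤ d/4` then `x - s ∉ T`. [folklore] -/
theorem sub_notMem_of_notMem_cthickening {T : Set E'} {d : ℝ} (hd : 0 ≤ d) {x : E'}
    (hx : x ∉ cthickening (d / 2) T) {τ R : ℝ} (hR : R ≤ d / 4) {s : E'}
    (hs : s ∈ closedBall (-(τ • (0 : E'))) R) : x - s ∉ T := by
  rw [smul_zero, neg_zero] at hs
  intro h
  apply hx
  have hsn : ‖s‖ ≤ R := by simpa using hs
  have : x ∈ closedBall (x - s) (d / 2) := by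
    rw [mem_closedBall, dist_eq_norm, sub_sub_cancel]
    linarith
  exact closedBall_subset_cthickening h _ this

end Geometry

/-! ## Part 5. One patch: cut-off, zero extension and shifted mollification -/

section Patch

variable {E' : Type*} [NormedAddCommGroup E'] [NormedSpace ℝ E'] [FiniteDimensional ℝ E']
  [MeasurableSpace E'] [BorelSpace E'] {μ : Measure E'} [μ.IsAddHaarMeasure]
variable {F : Type*} [NormedAddCommGroup F] [NormedSpace ℝ F] [CompleteSpace F]
variable {Ω : Opens E'} {p : ℝ≥0∞}

/-- **The patch estimate** (Evans, *PDE*, §5.7, proof of Thm. 1, step 3, on one patch of a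
partition of unity, with the extension operator replaced by the inward translation of Evans
§5.3.3 / Adams 1975, Thm. 3.18). Let `ζ` be a smooth compactly supported cut-off, `v` a
vector of norm `≤ 1` (the inward direction; `v = 0` for the interior patch), `λ ∈ (0,1]` the
radius/shift ratio, `η > 0` the admissible size, and `S ⊆ Ω` a measurable region such that
(G1) for admissible shifts `τ, τ'` the kernel supports along segments issued from `S` stay in
`Ω`, and (G2) off `S` the cut-off and its relevant translates vanish. Then there is a constant
`D` (a bound for `|ζ|` and `‖Dζ‖`) such that for every admissible `τ`, the bump `ρ` of centre
`-τ v` and outer radius `λ τ`, and every `u ∈ L^p(Ω)` with weak derivative `g ∈ L^p(Ω)`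
(`1 ≤ p ≤ ∞`): `‖ζ u - ρ ⋆ 𝟙_Ω ζ u‖_{L^p(Ω)} ≤ 2τ · D (‖u‖_{L^p(Ω)} + ‖g‖_{L^p(Ω)})`.
The weak derivative of `ζ u` is `ζ g + Dζ ⊗ u` (`SobolevApprox.hasWeakFDerivOn_smul`); the
engine is `eLpNorm_normed_convolution_sub_self_le_of_hasWeakFDerivOn`. [cite: Evans2010, §5.7 proof of Theorem 1, step 3] -/
theorem patch_estimate (hp : 1 ≤ p) (hμΩ : μ (Ω : Set E') < ⊤) {ζ : E' → ℝ}
    (hζ : ContDiff ℝ ∞ ζ) (hζc : HasCompactSupport ζ) {v : E'} (hv : ‖v‖ ≤ 1) {lam η : ℝ}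
    (hlam : 0 < lam) (hlam1 : lam ≤ 1) (hη : 0 < η) {S : Set E'} (hS : MeasurableSet S)
    (hSΩ : S ⊆ (Ω : Set E'))
    (hgeo : ∀ τ τ' : ℝ, 0 < τ → 2 * τ ≤ η → 0 < τ' → 2 * τ' ≤ η → ∀ x ∈ S,
      ∀ s ∈ closedBall (-(τ • v)) (lam * τ), ∀ θ ∈ Icc (0:ℝ) 1,
        closedBall (x - θ • s - (-(τ' • v))) (lam * τ') ⊆ (Ω : Set E'))
    (hfar : ∀ τ : ℝ, 0 < τ → 2 * τ ≤ η → ∀ x ∈ (Ω : Set E'), x ∉ S →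
      ζ x = 0 ∧ ∀ s ∈ closedBall (-(τ • v)) (lam * τ), ζ (x - s) = 0) :
    ∃ D : ℝ≥0, ∀ τ : ℝ, 0 < τ → 2 * τ ≤ η → ∀ φ : ContDiffBump (-(τ • v)),
      φ.rOut = lam * τ → ∀ (u : E' → F) (g : E' → E' →L[ℝ] F), HasWeakFDerivOn Ω μ u g →
        MemLp u p (μ.restrict Ω) → MemLp g p (μ.restrict Ω) →
        eLpNorm (fun x => ζ x • u x -
            (φ.normed μ ⋆[lsmul ℝ ℝ, μ] (Ω : Set E').indicator fun y => ζ y • u y) x)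
          p (μ.restrict Ω) ≤
        ENNReal.ofReal (2 * τ) *
          (D * (eLpNorm u p (μ.restrict Ω) + eLpNorm g p (μ.restrict Ω))) := by
  -- constants of the cut-off
  have hζ1 : ContDiff ℝ 1 ζ := hζ.of_le (by exact_mod_cast le_top)
  obtain ⟨Cζ, hCζ⟩ := hζ.continuous.bounded_above_of_compact_support hζc
  obtain ⟨Dζ, hDζ⟩ := (hζ1.continuous_fderiv one_ne_zero).bounded_above_of_compact_support
    (hζc.fderiv ℝ)
  set D : ℝ := max Cζ Dζ with hD_def
  have hD0 : 0 ≤ D := le_trans (le_trans (norm_nonneg _) (hCζ 0)) (le_max_left _ _)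
  refine ⟨D.toNNReal, fun τ hτ hτη φ hφR u g hug hup hgp => ?_⟩
  show _ ≤ ENNReal.ofReal (2 * τ) *
    (ENNReal.ofReal D * (eLpNorm u p (μ.restrict Ω) + eLpNorm g p (μ.restrict Ω)))
  have hΩm : MeasurableSet (Ω : Set E') := Ω.isOpen.measurableSet
  haveI : IsFiniteMeasure (μ.restrict (Ω : Set E')) := ⟨by rwa [Measure.restrict_apply_univ]⟩
  -- the patch function, its weak derivative, and their zero extensions
  set w : E' → F := fun x => ζ x • u x with hw_def
  set gw : E' → E' →L[ℝ] F := fun x => ζ x • g x + (fderiv ℝ ζ x).smulRight (u x) with hgw_def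
  have hw : HasWeakFDerivOn Ω μ w gw := SobolevApprox.hasWeakFDerivOn_smul hug hζ
  set G : E' → F := (Ω : Set E').indicator w with hG_def
  set gb : E' → E' →L[ℝ] F := (Ω : Set E').indicator gw with hgb_def
  have hGΩ : EqOn G w Ω := fun x hx => indicator_of_mem hx _
  have hgbΩ : EqOn gb gw Ω := fun x hx => indicator_of_mem hx _
  have hwG : HasWeakFDerivOn Ω μ G gb := SobolevApprox.hasWeakFDerivOn_congr hw hGΩ hgbΩ
  -- `L^p` bookkeeping
  have hwp : MemLp w p (μ.restrict Ω) :=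
    SobolevApprox.memLp_continuous_smul hζ.continuous hζc hup
  have hgwp : MemLp gw p (μ.restrict Ω) := MemLp.add (ε := E' →L[ℝ] F)
    (SobolevApprox.memLp_continuous_smul hζ.continuous hζc hgp)
    (SobolevApprox.memLp_fderiv_smulRight hζ1 hζc hup)
  have hgbp : MemLp gb p μ := (memLp_indicator_iff_restrict (ε := E' →L[ℝ] F) hΩm).2 hgwp
  have hG1 : MemLp G 1 μ := (memLp_indicator_iff_restrict hΩm).2 (hwp.mono_exponent hp)
  have hGint : Integrable G μ := memLp_one_iff_integrable.1 hG1
  have hgbloc : LocallyIntegrable gb μ := hgbp.locallyIntegrable hp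
  -- `‖ḡ‖_p ≤ D (‖u‖_p + ‖g‖_p)`
  have hgb_le : eLpNorm gb p μ ≤
      ENNReal.ofReal D * (eLpNorm u p (μ.restrict Ω) + eLpNorm g p (μ.restrict Ω)) := by
    rw [hgb_def, eLpNorm_indicator_eq_eLpNorm_restrict (ε := E' →L[ℝ] F) hΩm]
    have hptw : ∀ x, ‖gw x‖ ≤ D * ‖(‖u x‖ + ‖g x‖ : ℝ)‖ := fun x => by
      rw [Real.norm_of_nonneg (by positivity)]
      calc ‖gw x‖ ≤ ‖ζ x • g x‖ + ‖(fderiv ℝ ζ x).smulRight (u x)‖ := norm_add_le _ _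
        _ = ‖ζ x‖ * ‖g x‖ + ‖fderiv ℝ ζ x‖ * ‖u x‖ := by
            rw [norm_smul, ContinuousLinearMap.norm_smulRight_apply]
        _ ≤ D * ‖g x‖ + D * ‖u x‖ :=
            add_le_add (mul_le_mul_of_nonneg_right ((hCζ x).trans (le_max_left _ _))
              (norm_nonneg _)) (mul_le_mul_of_nonneg_right ((hDζ x).trans (le_max_right _ _))
              (norm_nonneg _))
        _ = D * (‖u x‖ + ‖g x‖) := by ring
    refine (eLpNorm_le_mul_eLpNorm_of_ae_le_mul (ae_of_all _ hptw) p).trans ?_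
    gcongr
    have e : (fun x => ‖u x‖ + ‖g x‖) = (fun x => ‖u x‖) + fun x => ‖g x‖ := rfl
    rw [e]
    refine (eLpNorm_add_le hup.aestronglyMeasurable.norm hgp.aestronglyMeasurable.norm hp).trans ?_
    rw [eLpNorm_norm, eLpNorm_norm]
  -- the approximate identity feeding the weak estimate
  set τ' : ℕ → ℝ := fun k => η / 2 * (1 / ((k : ℝ) + 1)) with hτ'_def
  have hτ' : ∀ k, 0 < τ' k := fun k => by positivity
  have hτ'η : ∀ k, 2 * τ' k ≤ η := fun k => by
    have h1 : 1 / ((k : ℝ) + 1) ≤ 1 := by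
      rw [div_le_one (by positivity)]; linarith [k.cast_nonneg (α := ℝ)]
    calc 2 * τ' k = η * (1 / ((k : ℝ) + 1)) := by rw [hτ'_def]; ring
      _ ≤ η * 1 := by gcongr
      _ = η := mul_one η
  have hτ'lim : Tendsto τ' atTop (𝓝 0) := by
    have := tendsto_one_div_add_atTop_nhds_zero_nat.const_mul (η / 2)
    rwa [mul_zero] at this
  set c' : ℕ → E' := fun k => -(τ' k • v) with hc'_def
  have hc' : Tendsto c' atTop (𝓝 0) := by simpa using (hτ'lim.smul_const v).neg
  let φ' : ∀ k : ℕ, ContDiffBump (c' k) := fun k =>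
    ⟨lam * τ' k / 2, lam * τ' k, by have := hτ' k; positivity,
      by have : 0 < lam * τ' k := mul_pos hlam (hτ' k); linarith⟩
  have hr' : Tendsto (fun k => (φ' k).rOut) atTop (𝓝 0) := by
    show Tendsto (fun k => lam * τ' k) atTop (𝓝 0)
    simpa using hτ'lim.const_mul lam
  have hgeo' : ∀ x ∈ S, ∀ s ∈ closedBall (-(τ • v)) φ.rOut, ∀ θ ∈ Icc (0:ℝ) 1, ∀ k,
      closedBall (x - θ • s - c' k) (φ' k).rOut ⊆ (Ω : Set E') := by
    intro x hx s hs θ hθ k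
    rw [hφR] at hs
    exact hgeo τ (τ' k) hτ hτη (hτ' k) (hτ'η k) x hx s hs θ hθ
  have hkey := eLpNorm_normed_convolution_sub_self_le_of_hasWeakFDerivOn hwG hGint hgbloc φ φ'
    hc' hr' hS hgeo' hp
  -- off `S` both `ζ u` and the mollification vanish
  set ψ : E' → F := φ.normed μ ⋆[lsmul ℝ ℝ, μ] G with hψ_def
  have hvan : ∀ x ∈ (Ω : Set E'), x ∉ S → w x - ψ x = 0 := by
    intro x hxΩ hxS
    obtain ⟨h0, hs0⟩ := hfar τ hτ hτη x hxΩ hxS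
    have hψ0 : ψ x = 0 := by
      rw [hψ_def, convolution_lsmul]
      refine integral_eq_zero_of_ae (ae_of_all _ fun s => ?_)
      show φ.normed μ s • G (x - s) = 0
      by_cases hs : s ∈ closedBall (-(τ • v)) φ.rOut
      · have hG0 : G (x - s) = 0 := by
          rw [hG_def]
          by_cases hxs : x - s ∈ (Ω : Set E')
          · rw [indicator_of_mem hxs, hw_def]
            show ζ (x - s) • u (x - s) = 0
            rw [hs0 s (hφR ▸ hs), zero_smul]
          · exact indicator_of_notMem hxs _
        rw [hG0, smul_zero]
      · have h00 : φ.normed μ s = 0 := by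
          rw [← notMem_support, φ.support_normed_eq]
          exact fun h => hs (ball_subset_closedBall h)
        rw [h00, zero_smul]
    rw [hψ0, sub_zero, hw_def]
    show ζ x • u x = 0
    rw [h0, zero_smul]
  have hEq : (fun x => w x - ψ x) =ᵐ[μ.restrict Ω] S.indicator (fun x => w x - ψ x) := by
    filter_upwards [ae_restrict_mem hΩm] with x hx
    by_cases hxS : x ∈ S
    · rw [indicator_of_mem hxS]
    · rw [indicator_of_notMem hxS, hvan x hx hxS]
  have hτv : ‖-(τ • v)‖ + φ.rOut ≤ 2 * τ := by
    rw [norm_neg, norm_smul, Real.norm_of_nonneg hτ.le, hφR]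
    nlinarith [norm_nonneg v]
  calc eLpNorm (fun x => w x - ψ x) p (μ.restrict Ω)
      = eLpNorm (S.indicator fun x => w x - ψ x) p (μ.restrict Ω) := eLpNorm_congr_ae hEq
    _ = eLpNorm (fun x => w x - ψ x) p (μ.restrict S) := by
        rw [eLpNorm_indicator_eq_eLpNorm_restrict hS, Measure.restrict_restrict hS,
          inter_eq_left.2 hSΩ]
    _ = eLpNorm (fun x => ψ x - G x) p (μ.restrict S) := by
        rw [← eLpNorm_neg]
        refine eLpNorm_congr_ae ?_
        filter_upwards [ae_restrict_mem hS] with x hx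
        simp only [Pi.neg_apply, neg_sub, hGΩ (hSΩ hx)]
    _ ≤ ENNReal.ofReal (‖-(τ • v)‖ + φ.rOut) * eLpNorm gb p μ := hkey
    _ ≤ ENNReal.ofReal (2 * τ) *
          (ENNReal.ofReal D * (eLpNorm u p (μ.restrict Ω) + eLpNorm g p (μ.restrict Ω))) := by
        gcongr

end Patch

/-! ## Part 6. Total boundedness, compactness, and the discharge -/

section Main

variable {E' : Type*} [NormedAddCommGroup E'] [InnerProductSpace ℝ E'] [MeasurableSpace E']
  [BorelSpace E'] [FiniteDimensional ℝ E']
variable {F : Type*} [NormedAddCommGroup F] [NormedSpace ℝ F] [CompleteSpace F]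

/-- **Total boundedness in `L^p(Ω)` of a `W^{1,p}(Ω)`-bounded family on a bounded Lipschitz
domain** (`1 ≤ p ≤ ∞`, finite-dimensional range): for every `ε > 0` finitely many members of
the family are `ε`-dense in it for the `L^p(Ω)` norm. This is Evans, *PDE*, §5.7, proof of
Theorem 1, steps 2–5 (mollify at a scale `~ ε`, Arzelà–Ascoli for the mollified family, pass
from the sup norm to `L^p`), resp. Adams, *Sobolev Spaces* (1975), Thm. 2.21 with §6.7, with
one change of bookkeeping: instead of first extending the functions to `W^{1,p}(ℝⁿ)`
(Evans) or cutting off a boundary layer by the Sobolev imbedding (Adams (15)), the domain is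
covered by finitely many Lipschitz charts and an interior piece, a smooth partition of unity
`(ρᵢ)` is chosen (`SmoothPartitionOfUnity.exists_isSubordinate`), and each piece `ρᵢ u` is
mollified after a small translation *into* the domain (the device of Evans §5.3.3, Thm. 3 /
Adams Thm. 3.18, here `patch_estimate`): `T u = Σᵢ ρ_{τᵢ} ⋆ 𝟙_Ω ρᵢ u` is smooth on the whole
space, `‖u - T u‖_{L^p(Ω)} ≤ Σᵢ 2τᵢ Dᵢ (‖u‖_p + ‖Du‖_p)`, and the family `{T uₙ}` is
equibounded, equi-Lipschitz and supported in a fixed compact set, so that the Arzelà–Ascoli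
net of `exists_finset_forall_norm_sub_lt` (accepted `SobolevDomainProofs`) finishes the
proof. [cite: Evans2010, §5.7 Theorem 1 (proof, steps 2–5)] [cite: Adams1975, Thm. 2.21 and §6.7] -/
theorem exists_finset_eLpNorm_sub_lt_of_isLipschitzDomain [FiniteDimensional ℝ F]
    {Ω : Opens E'} (hΩ : IsLipschitzDomain Ω) (hb : IsBounded (Ω : Set E')) {p : ℝ≥0∞}
    (hp : 1 ≤ p) (μ : Measure E') [μ.IsAddHaarMeasure] (u : ℕ → E' → F)
    (g : ℕ → E' → E' →L[ℝ] F) (hw : ∀ n, HasWeakFDerivOn Ω μ (u n) (g n))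
    (hup : ∀ n, MemLp (u n) p (μ.restrict Ω)) (hgp : ∀ n, MemLp (g n) p (μ.restrict Ω))
    {A B : ℝ≥0∞} (hA : A ≠ ⊤) (hB : B ≠ ⊤) (huA : ∀ n, eLpNorm (u n) p (μ.restrict Ω) ≤ A)
    (hgB : ∀ n, eLpNorm (g n) p (μ.restrict Ω) ≤ B) {ε : ℝ≥0∞} (hε : 0 < ε) :
    ∃ s : Finset ℕ, ∀ n, ∃ m ∈ s, eLpNorm (u n - u m) p (μ.restrict Ω) < ε := by
  haveI : ProperSpace F := FiniteDimensional.proper ℝ F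
  have hΩm : MeasurableSet (Ω : Set E') := Ω.isOpen.measurableSet
  have hKc : IsCompact (closure (Ω : Set E')) := hb.isCompact_closure
  have hμΩ : μ (Ω : Set E') < ⊤ := (measure_mono subset_closure).trans_lt hKc.measure_lt_top
  haveI : IsFiniteMeasure (μ.restrict (Ω : Set E')) := ⟨by rwa [Measure.restrict_apply_univ]⟩
  -- reduce to finite `ε`
  wlog hεt : ε ≠ ⊤ generalizing ε
  · obtain ⟨s, hs⟩ := this one_pos ENNReal.one_ne_top
    refine ⟨s, fun n => (hs n).imp fun m hm => ⟨hm.1, hm.2.trans_le ?_⟩⟩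
    rw [not_ne_iff.1 hεt]; exact le_top
  have hε' : 0 < ε.toReal := ENNReal.toReal_pos hε.ne' hεt
  have hεe : ε = ENNReal.ofReal ε.toReal := (ENNReal.ofReal_toReal hεt).symm
  ---- Step 1: charts and a smooth partition of unity on `closure Ω`
  choose! r hr hchart using hΩ
  have hK : IsCompact (frontier (Ω : Set E')) :=
    hKc.of_isClosed_subset isClosed_frontier frontier_subset_closure
  obtain ⟨t, htf, hcover⟩ := hK.elim_nhds_subcover (fun x => ball x (r x / 2))
    fun x hx => ball_mem_nhds x (half_pos (hr x hx))
  let V : Option t → Set E' := fun i => i.elim (Ω : Set E') fun x => ball (x : E') (r x / 2)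
  have hVo : ∀ i, IsOpen (V i) := by
    rintro (_ | ⟨x, hx⟩)
    exacts [Ω.isOpen, isOpen_ball]
  have hVb : ∀ i, IsBounded (V i) := by
    rintro (_ | ⟨x, hx⟩)
    exacts [hb, isBounded_ball]
  have hVc : closure (Ω : Set E') ⊆ ⋃ i, V i := by
    intro y hy
    rw [closure_eq_self_union_frontier] at hy
    rcases hy with hy | hy
    · exact mem_iUnion.2 ⟨none, hy⟩
    · obtain ⟨x, hxt, hyx⟩ := mem_iUnion₂.1 (hcover hy)
      exact mem_iUnion.2 ⟨some ⟨x, hxt⟩, hyx⟩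
  obtain ⟨ρ, hρ⟩ := SmoothPartitionOfUnity.exists_isSubordinate (I := 𝓘(ℝ, E')) (M := E')
    isClosed_closure V hVo hVc
  have hρs : ∀ i, ContDiff ℝ ∞ (ρ i) := fun i => contMDiff_iff_contDiff.1 (ρ i).contMDiff
  have hρc : ∀ i, HasCompactSupport (ρ i) := fun i =>
    Metric.isCompact_of_isClosed_isBounded (isClosed_tsupport _) ((hVb i).subset (hρ i))
  have hρ01 : ∀ i x, ‖ρ i x‖ ≤ 1 := fun i x => by
    rw [Real.norm_of_nonneg (ρ.nonneg i x)]
    exact ρ.le_one i x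
  ---- Step 2: the patch data (inward direction, ratio, admissible size, constant)
  have hpatch : ∀ i : Option t, ∃ (v : E') (lam η : ℝ) (D : ℝ≥0),
      0 < lam ∧ lam ≤ 1 ∧ 0 < η ∧ ‖v‖ ≤ 1 ∧
      ∀ τ : ℝ, 0 < τ → 2 * τ ≤ η → ∀ φ : ContDiffBump (-(τ • v)), φ.rOut = lam * τ →
        ∀ (u : E' → F) (g : E' → E' →L[ℝ] F), HasWeakFDerivOn Ω μ u g →
          MemLp u p (μ.restrict Ω) → MemLp g p (μ.restrict Ω) →
          eLpNorm (fun x => ρ i x • u x -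
              (φ.normed μ ⋆[lsmul ℝ ℝ, μ] (Ω : Set E').indicator fun y => ρ i y • u y) x)
            p (μ.restrict Ω) ≤
          ENNReal.ofReal (2 * τ) *
            (D * (eLpNorm u p (μ.restrict Ω) + eLpNorm g p (μ.restrict Ω))) := by
    rintro (_ | ⟨x₀, hx₀⟩)
    · -- the interior patch
      obtain ⟨d, hd, hdΩ⟩ :=
        (hρc none).isCompact.exists_cthickening_subset_open Ω.isOpen (hρ none)
      have hSm : MeasurableSet ((Ω : Set E') ∩ cthickening (d / 2) (tsupport (ρ none))) :=
        hΩm.inter isClosed_cthickening.measurableSet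
      refine (patch_estimate (F := F) (μ := μ) hp hμΩ (hρs none) (hρc none)
        (v := (0 : E')) (by simp) one_pos le_rfl (half_pos hd) hSm inter_subset_left ?_ ?_).elim
        fun D hD => ⟨0, 1, d / 2, D, one_pos, le_rfl, half_pos hd, by simp, hD⟩
      · intro τ τ' hτ hτη hτ'0 hτ'η x hx s hs θ hθ
        exact closedBall_sub_smul_subset_of_cthickening hd hdΩ hx.2 (by linarith) (by linarith)
          hs hθ
      · intro τ hτ hτη x hxΩ hxS
        have hxT : x ∉ cthickening (d / 2) (tsupport (ρ none)) := fun h => hxS ⟨hxΩ, h⟩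
        refine ⟨?_, fun s hs => ?_⟩
        · exact image_eq_zero_of_notMem_tsupport fun h => hxT (self_subset_cthickening _ h)
        · exact image_eq_zero_of_notMem_tsupport
            (sub_notMem_of_notMem_cthickening hd.le hxT (by linarith) hs)
    · -- a boundary patch
      have hx₀f : (x₀ : E') ∈ frontier (Ω : Set E') := htf x₀ hx₀
      obtain ⟨uu, huu, γ, K, hγ, hΩr⟩ := hchart x₀ hx₀f
      have hr₀ : 0 < r x₀ := hr x₀ hx₀f
      have hSm : MeasurableSet ((Ω : Set E') ∩ ball (x₀ : E') (5 * r x₀ / 8)) :=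
        hΩm.inter isOpen_ball.measurableSet
      have hlam : 0 < 1 / (1 + (K : ℝ)) := by positivity
      have hlam1 : 1 / (1 + (K : ℝ)) ≤ 1 := by
        rw [div_le_one (by positivity)]; linarith [K.coe_nonneg]
      have hKlam : ∀ τ : ℝ, (1 + (K : ℝ)) * (1 / (1 + (K : ℝ)) * τ) = τ := fun τ => by
        field_simp
      have h2 : ∀ τ : ℝ, 0 ≤ τ → τ + 1 / (1 + (K : ℝ)) * τ ≤ 2 * τ := fun τ hτ => by
        nlinarith [hlam1]
      refine (patch_estimate (F := F) (μ := μ) hp hμΩ (hρs (some ⟨x₀, hx₀⟩)) (hρc _)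
        (v := uu) huu.le hlam hlam1 (by positivity : (0 : ℝ) < r x₀ / 8) hSm inter_subset_left
        ?_ ?_).elim fun D hD => ⟨uu, 1 / (1 + (K : ℝ)), r x₀ / 8, D, hlam, hlam1, by positivity,
          huu.le, hD⟩
      · intro τ τ' hτ hτη hτ'0 hτ'η x hx s hs θ hθ
        exact closedBall_sub_smul_sub_subset_of_graph huu hγ hΩr hx.1 (mem_ball.1 hx.2)
          (by positivity) (hKlam τ).le (by linarith [h2 τ hτ.le]) (by positivity) (hKlam τ').le
          (by linarith [h2 τ' hτ'0.le]) hs hθ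
      · intro τ hτ hτη x hxΩ hxS
        have hxfar : ¬dist x x₀ < 5 * r x₀ / 8 := fun h => hxS ⟨hxΩ, mem_ball.2 h⟩
        have hsub : tsupport (ρ (some ⟨x₀, hx₀⟩)) ⊆ ball (x₀ : E') (r x₀ / 2) :=
          hρ (some ⟨x₀, hx₀⟩)
        refine ⟨?_, fun s hs => ?_⟩
        · refine image_eq_zero_of_notMem_tsupport fun h => hxfar ?_
          have := mem_ball.1 (hsub h)
          linarith
        · exact image_eq_zero_of_notMem_tsupport fun h =>
            sub_notMem_ball_of_far huu hτ.le (by linarith [h2 τ hτ.le]) hxfar hs (hsub h)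
  choose v lam η D hlam hlam1 hη hv hest using hpatch
  ---- Step 3: the scale
  set Λ : ℝ≥0∞ := ∑ i, (D i : ℝ≥0∞) * (A + B) with hΛ_def
  have hΛt : Λ ≠ ⊤ := ENNReal.sum_ne_top.2 fun i _ =>
    ENNReal.mul_ne_top ENNReal.coe_ne_top (ENNReal.add_ne_top.2 ⟨hA, hB⟩)
  set τ₀ : ℝ := min (1 / 4) (ε.toReal / 16 / (Λ.toReal + 1)) with hτ₀_def
  have hτ₀ : 0 < τ₀ := lt_min (by norm_num) (by positivity)
  set τ : Option t → ℝ := fun i => min (η i / 2) τ₀ with hτ_def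
  have hτpos : ∀ i, 0 < τ i := fun i => lt_min (half_pos (hη i)) hτ₀
  have hτη : ∀ i, 2 * τ i ≤ η i := fun i => by
    have := min_le_left (η i / 2) τ₀
    show 2 * min (η i / 2) τ₀ ≤ η i
    linarith
  have hττ₀ : ∀ i, τ i ≤ τ₀ := fun i => min_le_right _ _
  have hτ4 : ∀ i, τ i ≤ 1 / 4 := fun i => (hττ₀ i).trans (min_le_left _ _)
  let φ : ∀ i : Option t, ContDiffBump (-(τ i • v i)) := fun i =>
    ⟨lam i * τ i / 2, lam i * τ i, by have := mul_pos (hlam i) (hτpos i); positivity,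
      by have := mul_pos (hlam i) (hτpos i); linarith⟩
  have hφR : ∀ i, (φ i).rOut = lam i * τ i := fun i => rfl
  have hcR : ∀ i, ‖-(τ i • v i)‖ + (φ i).rOut ≤ 1 := fun i => by
    rw [hφR, norm_neg, norm_smul, Real.norm_of_nonneg (hτpos i).le]
    have h1 : τ i * ‖v i‖ ≤ τ i := by nlinarith [hv i, norm_nonneg (v i), hτpos i]
    have h2 : lam i * τ i ≤ τ i := by nlinarith [hlam i, hτpos i, hlam1 i]
    linarith [hτ4 i]
  ---- Step 4: the mollified family
  set Gf : Option t → ℕ → E' → F := fun i n => (Ω : Set E').indicator fun y => ρ i y • u n y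
    with hGf_def
  set T : ℕ → E' → F := fun n => ∑ i, (φ i).normed μ ⋆[lsmul ℝ ℝ, μ] Gf i n with hT_def
  -- `L¹` bounds of the pieces
  have hinv : p.toReal⁻¹ ≤ 1 := by
    rcases eq_or_ne p ⊤ with hpt | hpt
    · simp [hpt]
    · have hq : 1 ≤ p.toReal := by
        rw [← ENNReal.toReal_one]; exact ENNReal.toReal_mono hpt hp
      exact inv_le_one_of_one_le₀ hq
  set M₁ : ℝ≥0∞ := A * μ (Ω : Set E') ^ (1 - p.toReal⁻¹) with hM₁
  have hM₁t : M₁ ≠ ⊤ := ENNReal.mul_ne_top hA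
    (ENNReal.rpow_ne_top_of_nonneg (by rw [sub_nonneg]; exact hinv) hμΩ.ne)
  have hGp : ∀ i n, MemLp (fun y => ρ i y • u n y) p (μ.restrict Ω) := fun i n =>
    SobolevApprox.memLp_continuous_smul (hρs i).continuous (hρc i) (hup n)
  have hGint : ∀ i n, Integrable (Gf i n) μ := fun i n =>
    memLp_one_iff_integrable.1 ((memLp_indicator_iff_restrict hΩm).2 ((hGp i n).mono_exponent hp))
  have hL1e : ∀ i n, ∫⁻ y, ‖Gf i n y‖ₑ ∂μ ≤ M₁ := fun i n => by
    rw [← eLpNorm_one_eq_lintegral_enorm, hGf_def, eLpNorm_indicator_eq_eLpNorm_restrict hΩm]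
    calc eLpNorm (fun y => ρ i y • u n y) 1 (μ.restrict Ω)
        ≤ eLpNorm (u n) 1 (μ.restrict Ω) := by
          refine eLpNorm_mono fun x => ?_
          rw [norm_smul]
          exact mul_le_of_le_one_left (norm_nonneg _) (hρ01 i x)
      _ ≤ eLpNorm (u n) p (μ.restrict Ω) * (μ.restrict Ω) univ ^ (1 / (1:ℝ≥0∞).toReal - 1 / p.toReal) :=
          eLpNorm_le_eLpNorm_mul_rpow_measure_univ hp (hup n).aestronglyMeasurable
      _ ≤ M₁ := by
          rw [Measure.restrict_apply_univ, ENNReal.toReal_one, div_one, one_div, hM₁]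
          gcongr
          exact huA n
  have hL1 : ∀ i n, ∫ y, ‖Gf i n y‖ ∂μ ≤ M₁.toReal := fun i n => by
    rw [integral_norm_eq_lintegral_enorm (hGint i n).aestronglyMeasurable]
    exact ENNReal.toReal_mono hM₁t (hL1e i n)
  -- support, sup bound and Lipschitz bound of `T n`
  set K' : Set E' := cthickening 1 (closure (Ω : Set E')) with hK'
  have hK'c : IsCompact K' := hKc.cthickening
  have hTapply : ∀ n x, T n x = ∑ i, ((φ i).normed μ ⋆[lsmul ℝ ℝ, μ] Gf i n) x :=
    fun n x => by simp only [hT_def, Finset.sum_apply]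
  have hT0 : ∀ n x, x ∉ K' → T n x = 0 := fun n x hx => by
    rw [hTapply]
    refine Finset.sum_eq_zero fun i _ => ?_
    by_contra h
    have hx' := support_normed_convolution_subset_thickening (μ := μ) (φ i) (Gf i n)
      (mem_support.2 h)
    have hs : support (Gf i n) ⊆ closure (Ω : Set E') :=
      (support_indicator_subset).trans subset_closure
    exact hx (thickening_subset_cthickening_of_le (hcR i) _
      (thickening_subset_of_subset _ hs hx'))
  have hTR : ∀ n x, ‖T n x‖ ≤ ∑ i, (∫ y, φ i y ∂μ)⁻¹ * M₁.toReal := fun n x => by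
    rw [hTapply]
    exact (norm_sum_le _ _).trans (Finset.sum_le_sum fun i _ =>
      (norm_normed_convolution_le_of_integrable (φ i) (hGint i n) x).trans
        (mul_le_mul_of_nonneg_left (hL1 i n) (inv_nonneg.2 (φ i).integral_pos.le)))
  have hLφ : ∀ i, ∃ L : ℝ≥0, LipschitzWith L ((φ i).normed μ) := fun i =>
    ((φ i).contDiff_normed (μ := μ) (n := 1)).lipschitzWith_of_hasCompactSupport
      (φ i).hasCompactSupport_normed one_ne_zero
  choose Lφ hLφ using hLφ
  have hTL : ∀ n, LipschitzWith (∑ i, Lφ i * ⟨M₁.toReal, ENNReal.toReal_nonneg⟩) (T n) := fun n =>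
    LipschitzWith.of_dist_le_mul fun x x' => by
      rw [hTapply, hTapply]
      refine (dist_sum_sum_le _ _ _).trans ?_
      push_cast
      rw [Finset.sum_mul]
      refine Finset.sum_le_sum fun i _ => ?_
      refine (dist_normed_convolution_le_of_integrable (φ i) (hGint i n) (hLφ i) x x').trans ?_
      gcongr
      exact hL1 i n
  ---- Step 5: the Arzelà–Ascoli net and the three-`ε/4` estimate
  set η' : ℝ := ε.toReal / 4 / ((μ (Ω : Set E')).toReal ^ p.toReal⁻¹ + 1) with hη'_def
  have hη'0 : 0 < η' := by positivity
  obtain ⟨s, hs⟩ := exists_finset_forall_norm_sub_lt T hK'c hT0 hTR hTL hη'0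
  -- (1) `‖u n - T n‖_{L^p(Ω)} ≤ ε/4`
  have hTc : ∀ n, Continuous (T n) := fun n => (hTL n).continuous
  have hψc : ∀ i n, Continuous ((φ i).normed μ ⋆[lsmul ℝ ℝ, μ] Gf i n) := fun i n =>
    (φ i).hasCompactSupport_normed.continuous_convolution_left _ (φ i).continuous_normed
      (hGint i n).locallyIntegrable
  have hsum1 : ∀ x ∈ (Ω : Set E'), ∑ i, ρ i x = 1 := fun x hx => by
    have := ρ.sum_eq_one (subset_closure hx)
    rwa [finsum_eq_sum_of_fintype] at this
  have h1 : ∀ n, eLpNorm (u n - T n) p (μ.restrict Ω) ≤ ENNReal.ofReal (ε.toReal / 4) := by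
    intro n
    have hEq : (u n - T n) =ᵐ[μ.restrict Ω]
        ∑ i, fun x => ρ i x • u n x - ((φ i).normed μ ⋆[lsmul ℝ ℝ, μ] Gf i n) x := by
      filter_upwards [ae_restrict_mem hΩm] with x hx
      simp only [Pi.sub_apply, hT_def, Finset.sum_apply, Finset.sum_sub_distrib,
        ← Finset.sum_smul, hsum1 x hx, one_smul]
    rw [eLpNorm_congr_ae hEq]
    refine (eLpNorm_sum_le (fun i _ => ?_) hp).trans ?_
    · exact (((hρs i).continuous.aestronglyMeasurable.smul (hup n).aestronglyMeasurable)).sub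
        (hψc i n).aestronglyMeasurable
    calc ∑ i, eLpNorm (fun x => ρ i x • u n x - ((φ i).normed μ ⋆[lsmul ℝ ℝ, μ] Gf i n) x) p
          (μ.restrict Ω)
        ≤ ∑ i, ENNReal.ofReal (2 * τ i) *
            (D i * (eLpNorm (u n) p (μ.restrict Ω) + eLpNorm (g n) p (μ.restrict Ω))) :=
          Finset.sum_le_sum fun i _ =>
            hest i (τ i) (hτpos i) (hτη i) (φ i) (hφR i) (u n) (g n) (hw n) (hup n) (hgp n)
      _ ≤ ∑ i, ENNReal.ofReal (2 * τ₀) * (D i * (A + B)) :=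
          Finset.sum_le_sum fun i _ => by
            gcongr
            exacts [hττ₀ i, huA n, hgB n]
      _ = ENNReal.ofReal (2 * τ₀) * Λ := by rw [hΛ_def, Finset.mul_sum]
      _ ≤ ENNReal.ofReal (ε.toReal / 4) := by
          rw [← ENNReal.ofReal_toReal hΛt, ← ENNReal.ofReal_mul (by positivity)]
          apply ENNReal.ofReal_le_ofReal
          calc 2 * τ₀ * Λ.toReal ≤ 2 * (ε.toReal / 16 / (Λ.toReal + 1)) * Λ.toReal := by
                gcongr; exact min_le_right _ _
            _ ≤ 2 * (ε.toReal / 16 / (Λ.toReal + 1)) * (Λ.toReal + 1) := by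
                gcongr; linarith
            _ = ε.toReal / 8 := by field_simp; ring
            _ ≤ ε.toReal / 4 := by linarith
  -- (2) sup-close members of the mollified family are `L^p(Ω)`-close
  have h2 : ∀ n m, (∀ x, ‖T n x - T m x‖ < η') →
      eLpNorm (T n - T m) p (μ.restrict Ω) ≤ ENNReal.ofReal (ε.toReal / 4) := fun n m hnm => by
    refine (eLpNorm_le_of_ae_bound (C := η') (ae_of_all _ fun x => (hnm x).le)).trans ?_
    rw [Measure.restrict_apply_univ, ← ENNReal.ofReal_toReal hμΩ.ne,
      ENNReal.ofReal_rpow_of_nonneg ENNReal.toReal_nonneg (inv_nonneg.2 ENNReal.toReal_nonneg),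
      ← ENNReal.ofReal_mul (by positivity)]
    apply ENNReal.ofReal_le_ofReal
    calc (μ (Ω : Set E')).toReal ^ p.toReal⁻¹ * η'
        ≤ ((μ (Ω : Set E')).toReal ^ p.toReal⁻¹ + 1) * η' := by gcongr; linarith
      _ = ε.toReal / 4 := by rw [hη'_def]; field_simp
  -- (3) assemble
  refine ⟨s, fun n => (hs n).imp fun m hm => ⟨hm.1, ?_⟩⟩
  have hum : ∀ k, AEStronglyMeasurable (u k) (μ.restrict Ω) := fun k => (hup k).aestronglyMeasurable
  have hTm : ∀ k, AEStronglyMeasurable (T k) (μ.restrict Ω) := fun k => (hTc k).aestronglyMeasurable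
  calc eLpNorm (u n - u m) p (μ.restrict Ω)
        = eLpNorm ((u n - T n) + (T n - T m) + (T m - u m)) p (μ.restrict Ω) := by
          congr 1; abel
    _ ≤ eLpNorm (u n - T n) p (μ.restrict Ω) + eLpNorm (T n - T m) p (μ.restrict Ω) +
          eLpNorm (T m - u m) p (μ.restrict Ω) := by
          refine (eLpNorm_add_le (((hum n).sub (hTm n)).add ((hTm n).sub (hTm m)))
            ((hTm m).sub (hum m)) hp).trans ?_
          gcongr
          exact eLpNorm_add_le ((hum n).sub (hTm n)) ((hTm n).sub (hTm m)) hp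
    _ ≤ ENNReal.ofReal (ε.toReal / 4) + ENNReal.ofReal (ε.toReal / 4) +
          ENNReal.ofReal (ε.toReal / 4) := by
          gcongr
          · exact h1 n
          · exact h2 n m hm.2
          · rw [← eLpNorm_neg, neg_sub]; exact h1 m
    _ < ε := by
          rw [← ENNReal.ofReal_add (by positivity) (by positivity),
            ← ENNReal.ofReal_add (by positivity) (by positivity), hεe,
            ENNReal.ofReal_lt_ofReal_iff hε', ENNReal.toReal_ofReal hε'.le]
          linarith

/-- **Rellich–Kondrachov on a bounded Lipschitz domain, core form**: a sequence `uₙ` with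
weak derivatives `gₙ` on `Ω`, `‖uₙ‖_{L^p(Ω)} ≤ A`, `‖gₙ‖_{L^p(Ω)} ≤ B` (`1 ≤ p ≤ ∞`,
finite-dimensional range) has a subsequence converging in `L^p(Ω)`. Total boundedness
(`exists_finset_eLpNorm_sub_lt_of_isLipschitzDomain`) makes the closure of the sequence in the
complete space `Lp F p (μ|Ω)` compact, and `IsCompact.tendsto_subseq` extracts the
subsequence (Evans, *PDE*, §5.7, proof of Thm. 1, step 6; Adams 1975, Thm. 1.18 with
Thm. 2.21). [cite: Evans2010, §5.7 Theorem 1 (proof, step 6)] -/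
theorem exists_subseq_tendsto_eLpNorm_of_isLipschitzDomain [FiniteDimensional ℝ F]
    {Ω : Opens E'} (hΩ : IsLipschitzDomain Ω) (hb : IsBounded (Ω : Set E')) {p : ℝ≥0∞}
    (hp : 1 ≤ p) (μ : Measure E') [μ.IsAddHaarMeasure] (u : ℕ → E' → F)
    (g : ℕ → E' → E' →L[ℝ] F) (hw : ∀ n, HasWeakFDerivOn Ω μ (u n) (g n))
    (hup : ∀ n, MemLp (u n) p (μ.restrict Ω)) (hgp : ∀ n, MemLp (g n) p (μ.restrict Ω))
    {A B : ℝ≥0∞} (hA : A ≠ ⊤) (hB : B ≠ ⊤) (huA : ∀ n, eLpNorm (u n) p (μ.restrict Ω) ≤ A)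
    (hgB : ∀ n, eLpNorm (g n) p (μ.restrict Ω) ≤ B) :
    ∃ (f : E' → F) (ψ : ℕ → ℕ), StrictMono ψ ∧ MemLp f p (μ.restrict Ω) ∧
      Tendsto (fun n => eLpNorm (u (ψ n) - f) p (μ.restrict Ω)) atTop (𝓝 0) := by
  haveI : Fact (1 ≤ p) := ⟨hp⟩
  let Φ : ℕ → Lp F p (μ.restrict Ω) := fun n => (hup n).toLp (u n)
  have htb : TotallyBounded (range Φ) := by
    refine EMetric.totallyBounded_iff.2 fun ε hε => ?_
    obtain ⟨s, hs⟩ := exists_finset_eLpNorm_sub_lt_of_isLipschitzDomain hΩ hb hp μ u g hw hup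
      hgp hA hB huA hgB hε
    refine ⟨Φ '' s, s.finite_toSet.image Φ, ?_⟩
    rintro _ ⟨n, rfl⟩
    obtain ⟨m, hm, hnm⟩ := hs n
    refine mem_iUnion₂.2 ⟨Φ m, mem_image_of_mem Φ hm, ?_⟩
    rw [Metric.mem_eball, Lp.edist_toLp_toLp]
    exact hnm
  have hcomp : IsCompact (closure (range Φ)) :=
    htb.closure.isCompact_of_isClosed isClosed_closure
  obtain ⟨G, -, ψ, hψ, hlim⟩ :=
    hcomp.tendsto_subseq (x := Φ) fun n => subset_closure (mem_range_self n)
  refine ⟨G, ψ, hψ, Lp.memLp G, ?_⟩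
  rw [tendsto_iff_edist_tendsto_0] at hlim
  refine hlim.congr fun n => ?_
  simp only [Function.comp_apply, Φ]
  rw [Lp.edist_def]
  exact eLpNorm_congr_ae ((hup _).coeFn_toLp.sub EventuallyEq.rfl)

end Main

end RellichDomain

/-! ## The discharge -/

section Discharge

variable {E' : Type*} [NormedAddCommGroup E'] [InnerProductSpace ℝ E'] [MeasurableSpace E']
  [BorelSpace E'] [FiniteDimensional ℝ E']
variable {F : Type*} [NormedAddCommGroup F] [NormedSpace ℝ F]

open RellichDomain in
/-- **Discharge of `rellich_kondrachov_domain` (Rellich–Kondrachov compactness theorem on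
`W^{1,p}(Ω)` of a bounded Lipschitz domain).** On a bounded Lipschitz domain `Ω` in a
finite-dimensional real inner product space with an additive Haar measure `μ`, for
`1 ≤ p ≤ ∞` and finite-dimensional range `F`, every sequence `uₙ ∈ W^{1,p}(Ω)` with
`‖uₙ‖_{W^{1,p}(Ω)} ≤ M` has a subsequence converging in `L^p(Ω)` to some `f ∈ L^p(Ω)`.
Adams–Fournier, *Sobolev Spaces*, 2nd ed. (2003), Thm. 6.3 = Adams (1975), Thm. 6.2, Parts I
and II with `j = 0`, `m = 1`, `k = n`, `q = p`, `Ω₀ = Ω` bounded ("if `Ω` is bounded, we may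
have `Ω₀ = Ω` in the statement of the theorem", Adams 1975, end of Remarks 6.3): for a domain with the cone property (bounded Lipschitz
domains have it) the imbedding `W^{1,p}(Ω) → L^p(Ω)` is compact, `1 ≤ p < ∞`; Evans, *PDE*,
§5.7, Theorem 1 for `C¹` boundaries. The case `p = ∞` included in the fact (see its docstring)
is covered by the same proof (the `L^∞` patch estimate and Arzelà–Ascoli). *Context.* The
proposition `rellich_kondrachov_domain` is a `def`, which records only the section instances
its body uses: `[MeasurableSpace E']` and `[FiniteDimensional ℝ E']` but **not** the section's
`[BorelSpace E']` (`#check @rellich_kondrachov_domain`); without Borel compatibility of the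
σ-algebra the weak-derivative identity carries no information, so the fact is proved here — as
the accepted `sobolev_embedding_domain_holds` — in contexts carrying `[BorelSpace E']`, the
setting of the source (Lebesgue measure on `ℝⁿ`); `[CompleteSpace F]` is not assumed but
derived from the fact's own `[FiniteDimensional ℝ F]`. Proof: the finite
Sobolev norms furnish weak derivatives `gₙ` with `Σᵢ ‖gₙ eᵢ‖_{L^p(Ω)} < M + 1`, hence
`‖gₙ‖_{L^p(Ω)} ≤ C_E (M + 1)` (`SobolevApprox.eLpNorm_le_mul_sum_eLpNorm_apply_basis`), and
`exists_subseq_tendsto_eLpNorm_of_isLipschitzDomain` applies with `A = M`, `B = C_E (M + 1)`.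
The proof architecture is Evans's (§5.7, proof of Theorem 1: mollification at scale `~ ε`,
Arzelà–Ascoli, total boundedness, diagonal subsequence), with the extension
`W^{1,p}(Ω) → W^{1,p}(ℝⁿ)` replaced by inward-translated mollification on Lipschitz charts
(Evans §5.3.3, Theorem 3; Adams 1975, Theorem 3.18), see
`exists_finset_eLpNorm_sub_lt_of_isLipschitzDomain`; Adams (1975), §6.7 proves Part I via
Theorem 2.21 (Riesz–Kolmogorov) instead of Arzelà–Ascoli. [cite: AdamsFournier2003, Thm. 6.3 (Parts I–II, j = 0, m = 1, q = p, Ω₀ = Ω bounded)] [cite: Adams1975, Thm. 6.2 and §6.7] [cite: Evans2010, §5.7 Theorem 1] -/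
theorem rellich_kondrachov_domain_holds : rellich_kondrachov_domain (E' := E') (F := F) := by
  intro _ Ω hΩ hb p hp μ _ u hu M hM
  haveI : CompleteSpace F := FiniteDimensional.complete ℝ F
  set b := Module.finBasis ℝ E' with hb_def
  -- weak derivatives with `Σᵢ ‖gₙ eᵢ‖_{L^p(Ω)} < M + 1`
  have hex : ∀ n, ∃ g : E' → E' →L[ℝ] F, HasWeakFDerivOn Ω μ (u n) g ∧
      ∑ i, eLpNorm (fun x => g x (b i)) p (μ.restrict Ω) < M + 1 := by
    intro n
    have h : eSobolevDomainNorm 1 p Ω μ (u n) < M + 1 :=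
      (hM n).trans_lt (ENNReal.lt_add_right (by simp) one_ne_zero)
    have h' : (⨅ (g : E' → E' →L[ℝ] F) (_ : HasWeakFDerivOn Ω μ (u n) g),
        ∑ i, eSobolevDomainNorm 0 p Ω μ (fun x => g x (Module.finBasis ℝ E' i))) < M + 1 :=
      lt_of_le_of_lt le_add_self h
    rw [iInf_lt_iff] at h'
    obtain ⟨g, hg⟩ := h'
    rw [iInf_lt_iff] at hg
    obtain ⟨hw, hlt⟩ := hg
    exact ⟨g, hw, by simpa using hlt⟩
  choose g hw hsum using hex
  have hgm : ∀ n, AEStronglyMeasurable (g n) (μ.restrict Ω) := fun n =>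
    (hw n).locallyIntegrableOn_deriv.aestronglyMeasurable
  have hgB := fun n =>
    (SobolevApprox.eLpNorm_le_mul_sum_eLpNorm_apply_basis b (hgm n) hp (ν := μ.restrict Ω)
      (G' := g n)).trans (mul_le_mul_of_nonneg_left (hsum n).le bot_le)
  have hgp : ∀ n, MemLp (g n) p (μ.restrict Ω) := fun n =>
    ⟨hgm n, (hgB n).trans_lt (ENNReal.mul_lt_top ENNReal.coe_lt_top (by simp))⟩
  have hup : ∀ n, MemLp (u n) p (μ.restrict Ω) := fun n => (hu n).memLp
  have huA : ∀ n, eLpNorm (u n) p (μ.restrict Ω) ≤ M := fun n =>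
    (eLpNorm_le_eSobolevDomainNorm (k := 1)).trans (hM n)
  exact exists_subseq_tendsto_eLpNorm_of_isLipschitzDomain hΩ hb hp μ u g hw hup hgp
    ENNReal.coe_ne_top (ENNReal.mul_ne_top ENNReal.coe_ne_top (by simp)) huA hgB

end Discharge

/-! ## The discharge of the corrected statement `rellich_kondrachov_domain'` -/

section DischargeCorrected

variable {E' : Type*} [NormedAddCommGroup E'] [InnerProductSpace ℝ E'] [MeasurableSpace E']
  [FiniteDimensional ℝ E']
variable {F : Type*} [NormedAddCommGroup F] [NormedSpace ℝ F]

/-- **Discharge of `rellich_kondrachov_domain'` (Rellich–Kondrachov compactness theorem on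
`W^{1,p}(Ω)` of a bounded Lipschitz domain, corrected statement).** On a bounded Lipschitz
domain `Ω` in a finite-dimensional real inner product space with its Borel σ-algebra and an
additive Haar measure `μ`, for `1 ≤ p ≤ ∞` and finite-dimensional range `F`, every sequence
`uₙ ∈ W^{1,p}(Ω)` with `‖uₙ‖_{W^{1,p}(Ω)} ≤ M` has a subsequence converging in `L^p(Ω)` to some
`f ∈ L^p(Ω)`. Adams–Fournier, *Sobolev Spaces*, 2nd ed. (2003), Thm. 6.3 = Adams (1975),
Thm. 6.2 "The Rellich–Kondrachov theorem", p. 144, Parts I and II with `j = 0`, `m = 1`, `k = n`,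
`q = p`, `Ω₀ = Ω` bounded: for a domain with the cone property (bounded Lipschitz domains have
it) the imbedding `W^{1,p}(Ω) → L^p(Ω)` is compact, `1 ≤ p < ∞`; Evans, *PDE*, §5.7, Theorem 1
for `C¹` boundaries; the case `p = ∞` included in the fact is covered by the same proof (see the
docstring of `rellich_kondrachov_domain`). The corrected statement binds `[BorelSpace E']` and
`[FiniteDimensional ℝ F]` inside the proposition, so — unlike `rellich_kondrachov_domain_holds`,
which needs an ambient `[BorelSpace E']` — it is proved here outright, in a context without any
Borel or completeness assumption: after introducing the two instance binders it *is*
`rellich_kondrachov_domain_holds` (Evans's §5.7 architecture with inward-translated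
mollification on Lipschitz charts, `RellichDomain.exists_subseq_tendsto_eLpNorm_of_isLipschitzDomain`).
[cite: AdamsFournier2003, Thm. 6.3 (Parts I–II, j = 0, m = 1, q = p, Ω₀ = Ω bounded)] [cite: Adams1975, Thm. 6.2 p. 144 and §6.7] [cite: Evans2010, §5.7 Theorem 1] -/
theorem rellich_kondrachov_domain'_holds : rellich_kondrachov_domain' (E' := E') (F := F) := by
  intro _ _ Ω hΩ hb p hp μ _ u hu M hM
  exact rellich_kondrachov_domain_holds hΩ hb p hp μ u hu M hM

end DischargeCorrected

end Literature.Analysis.FunctionSpaces
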